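import Literature.Probability.LatticeModels.RandomWalkLoopMeasure
import Literature.Probability.RandomPlanarGeometry.LoopErasure
import HarnessLib

/-!
# Lawler's formula for the loop-erased measure of the simple random walk on a finite subgraph of `ℤ²`

Topic `Probability/LatticeModels`; namespace `Literature.Probability.LatticeModels`. A NAMED FACT
(`def … : Prop`, no proof claimed), vendored by the grounder of route
`Summits/CriticalPhenomena/SAWScalingLimit/Theses/SAWChargeContinuation` for its support item
`AnchorExcursion` (stmt-CriticalPhenomena-4926); it is the sub-graph form of the statement item
`LoopErasureIdentity` (stmt-CriticalPhenomena-4526, route SAWLoopAvoidanceChaos, typed there for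
`discreteDomainGraph Ω δ` and Mathlib's `Walk.bypass`).

## Source (read on the held copy `paper:arxiv-1709.07531`, arXiv page numbers)

G. F. Lawler, *Topics in loop measures and the loop-erased walk*, Probab. Surveys **15** (2018)
28–101, arXiv:1709.07531 [Lawler2018]:

* §2 (p. 5): a *weight* `q` on a finite set `A` gives every path `ω = [ω₀, …, ωₙ]` in `A` the
  weight `q(ω) = ∏ q(ω_{i-1}, ωᵢ)`; the Green's function is `G_A(x, y) = ∑_{ω : x → y} q(ω)`;
  "simple random walk in `ℤ^d` … viewed … as a Type II walk with `n = 2d`", i.e. `q ≡ 1/4` on the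
  edges used, killed otherwise.
* §3 Def. 1 (p. 8): the **chronological loop erasure** `LE(ω)`; Def. 2: the **loop-erased
  measure** `q̂(η) = ∑_{ω : LE(ω) = η} q(ω)`.
* **Prop. 3.1** (p. 8): "If `η = [η₀, η₁, …, η_m] ∈ 𝒲_A`, then
  `q̂(η) = q(η) ∏_{j=0}^{m} G_{A_j}(η_j, η_j)` where `A_j = A ∖ {η₀, …, η_{j-1}}`."
* Def. 3 / display before Prop. 5.2 (p. 17): `F_B(A) = ∏_{j=1}^{n} G_{A_j}(x_j, x_j)` for
  `B = {x₁, …, xₙ}`; **Prop. 5.2** (p. 17): "Suppose that `q` is an integrable weight on `A`. …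
  If `B ⊂ A`, then `F_B(A) = exp{m[ℒ(A; B)]}`", `m` the (unrooted) loop measure, `ℒ(A; B)` the
  loops in `A` meeting `B`; by Def. 8 / Def. 10 (p. 16) `m[ℒ(A; B)]` is the sum of the rooted loop
  measure `q(l)/|l|` over the rooted loops of positive length meeting `B` — the tree's
  `rwLoopMass` (`RandomWalkLoopMeasure.lean`, same topic) for `q ≡ 1/4` on a subgraph of `ℤ²`.

Combining Prop. 3.1 (with `B = {η₀, …, η_m}`, so that `∏_j G_{A_j}(η_j, η_j) = F_η(A)`) and
Prop. 5.2 gives the printed identity vendored below,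

  `∑_{ω : a → b, LE(ω) = η} q(ω) = q(η) · exp m[loops of A meeting η]`,

also Lawler–Limic, *Random Walk: A Modern Introduction* (2010), Prop. 9.5.1 with Lemma 9.3.2,
and Kozdron–Lawler (2007), §4 ("`ν̂^#_{LE}(A; z, w)(η) = 4^{-|η|} Θ_A(η)`").

## The specialisation typed here (item = fact ∘ specialisation)

`A` = the vertices of a subgraph `G ≤ ℤ²` (`zdGraph 2`) with finitely many edges, `q(x, y) = 1/4`
on the edges of `G` (Type II simple random walk killed at its first non-`G` step). This weight is
integrable in Lawler's sense (§2: `∑_ω |q|(ω) < ∞`): every component of a finite subgraph of `ℤ²`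
has a vertex of `G`-degree `< 4`, so the killed walk is strictly substochastic and irreducible on
each component — no extra hypothesis is printed or needed. Paths `ω : a → b` in `A` are the
`G.Walk a b`; `LE` is the tree's chronological `loopErase` (`RandomPlanarGeometry/LoopErasure.lean`,
Lawler's Def. 1 verbatim) applied to the vertex list `ω.support` (a walk of a simple graph is
determined by its vertex list, so `loopErase ω.support = η.support` says exactly `LE(ω) = η`);
`q(ω) = (1/4)^{|ω|}`; the right-hand side is `(1/4)^{|η|} · exp (rwLoopMass G η)`.

In route SAWChargeContinuation (`AnchorExcursion`, `WindowAvoidanceLaw` at `s = 1`, `y = 1/4`) the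
graph is the sub-graph `G D D' δ` of `D_δ` spanned by the edges inside `cl D'` between mesh points of
`D'`, and the inlined loop mass `m(γ)` there is token-for-token `rwLoopMass (G D D' δ) {v | v ∈ γ.walk.support}`;
summing the identity over the self-avoiding `η : a_δ → b_δ` gives
`Z(D_δ|D'; 1, 1/4) = ∑_{ω : a_δ → b_δ in G} 4^{-|ω|} = rwGreen (G D D' δ) a_δ b_δ`, the Green's
function of the walk killed off the sub-graph (Lawler 2018, Def. 2: `∑_η q̂(η) = q[𝒦_A(x, y)]`).

Grounds `Summit.CriticalPhenomena.SAWScalingLimit.Theses.SAWChargeContinuation.AnchorExcursion`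
(lattice half; the continuum half, [LSW03] Prop. 4.1, is the tree's
`exists_isRestrictionMeasure_one_brownianQuad`). No proof is claimed here (finite combinatorics of
loop insertion plus summability of the killed-walk series; sizeable); users take
`(h : tsum_loopErase_eq_exp_rwLoopMass)`.

## References

* G. F. Lawler, Probab. Surveys 15 (2018), arXiv:1709.07531: §2, §3 Def. 1–2, Prop. 3.1, §5.1
  Def. 8, Def. 10, Prop. 5.2. [Lawler2018]
* G. F. Lawler, V. Limic, *Random Walk: A Modern Introduction*, CUP (2010), Lemma 9.3.2,
  Prop. 9.5.1. [LawlerLimic2010]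
* M. J. Kozdron, G. F. Lawler, *The configurational measure on mutually avoiding SLE paths*,
  Fields Inst. Commun. 50 (2007), arXiv:math/0605159, §4 and §6. [KozdronLawler2007]
-/

noncomputable section

open Literature.Probability.RandomPlanarGeometry

namespace Literature.Probability.LatticeModels

/-- **Lawler's formula for the loop-erased measure** (Type II simple random walk, `q ≡ 1/4`, on a
subgraph `G` of `ℤ²` with finitely many edges): for every self-avoiding `η : a → b` in `G`,
`∑_{ω : a → b in G, LE(ω) = η} (1/4)^{|ω|} = (1/4)^{|η|} · exp m[loops of G meeting η]`, where `LE`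
is chronological loop erasure (`loopErase` on the vertex list) and `m` the random-walk loop measure
(`rwLoopMass`: rooted loops of positive length meeting `η`, weight `(1/4)^{|l|}/|l|`). Printed as
`q̂(η) = q(η) ∏_{j=0}^{m} G_{A_j}(η_j, η_j)` (Prop. 3.1) with `∏_j G_{A_j}(η_j, η_j) = F_η(A) =
exp{m[ℒ(A; η)]}` (Prop. 5.2), for an integrable weight `q` on a finite set `A`; here `A = V(G)`,
`q = 1/4` on `E(G)`, integrable because a finite subgraph of `ℤ²` has an escape in every component.
Grounds `Summit.CriticalPhenomena.SAWScalingLimit.Theses.SAWChargeContinuation.AnchorExcursion`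
(with `G` the sub-graph `G D D' δ` of that item) and is the sub-graph form of item
`LoopErasureIdentity` (stmt-CriticalPhenomena-4526). [cite: Lawler2018, Proposition 3.1 and Proposition 5.2] -/
def tsum_loopErase_eq_exp_rwLoopMass : Prop :=
  ∀ (G : SimpleGraph (Site 2)), G ≤ zdGraph 2 → G.edgeSet.Finite →
    ∀ (a b : Site 2) (η : G.Walk a b), η.IsPath →
      (∑' ω : G.Walk a b,
          (if loopErase ω.support = η.support then ((1 : ℝ) / 4) ^ ω.length else 0)) =
        ((1 : ℝ) / 4) ^ η.length * Real.exp (rwLoopMass G {v | v ∈ η.support})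

/-- Sanity check of the typing: on the one-vertex path `η = nil` at `a` the left-hand side counts
the closed walks at `a` whose loop erasure is trivial, i.e. ALL closed walks at `a` (the loop
erasure of a closed walk `a → a` is `[a]`), and the identity reads
`G(a, a) = ∑_{ω : a → a} (1/4)^{|ω|} = exp m[loops meeting a]` — Lawler 2018, Prop. 5.2, first
bullet. We record the list-level fact used: the loop erasure of a vertex list that starts and
ends at `a` is `[a]`. [folklore] -/
theorem loopErase_eq_singleton_of_head_eq_getLast {V : Type*} [DecidableEq V] (a : V)
    (l : List V) (h : (a :: l).getLast (List.cons_ne_nil a l) = a) :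
    loopErase (a :: l) = [a] := by
  rw [loopErase_cons]
  suffices afterLast a l = [] by simp [this]
  cases l with
  | nil => simp [afterLast]
  | cons b l' =>
    have hlast : (b :: l').getLast (List.cons_ne_nil b l') = a := by
      simpa [List.getLast_cons (List.cons_ne_nil b l')] using h
    -- the last element is `a`, so nothing comes after the last `a`
    unfold afterLast
    rw [List.rtakeWhile_eq_nil_iff]
    simpa using hlast

end Literature.Probability.LatticeModels

/-!
## Discharge of `tsum_loopErase_eq_exp_rwLoopMass` (appended; the statement above is unchanged)

`tsum_loopErase_eq_exp_rwLoopMass_holds` below PROVES the named fact, following the printed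
proofs of G. F. Lawler, *Topics in loop measures and the loop-erased walk*, Probab. Surveys 15
(2018), arXiv:1709.07531 [Lawler2018] (read on the held copy, arXiv page numbers): §2 pp. 5–6
(weights, paths, `G_A(x,x) = 1/(1 - f_x)`, eq. (nov17.1)), §3 p. 8 (Def. 1–2, **Prop. 3.1** and
its proof: the decomposition `ω = l_0 ⊕ [η_0,η_1] ⊕ l_1 ⊕ ⋯ ⊕ l_m`, `l_j ∈ 𝒦_{A_j}(η_j,η_j)`),
§5.1 pp. 16–18 (Def. 8–11, **Prop. 5.1**, **Prop. 5.2** and its proof: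
`m[ℒ(A;x)] = ∑_k k⁻¹ f_x^k = -log(1 - f_x) = log G_A(x,x)` and the partition
`ℒ(A;B) = ℒ(A;x_1) ∪ ℒ(A_1;x_2) ∪ ⋯`).

### Architecture (namespace `LoopErasedWalkIdentity`; all sums in `ℝ≥0∞`, `toReal` at the end)

* **Encoding.** A walk of the simple graph `G` is its vertex list (`walkEquivList`,
  `tsum_walk_eq_tsum_list`); a closed walk at `x` is `x :: t` with `t = []` or `t` ending in `x`
  (`IsLoopAt`), its length is `|t|`; a rooted loop of positive length is the nonempty list `t`
  rooted at its LAST entry (`IsCyc`), so that re-rooting at the next vertex is `List.rotate · 1`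
  (`isCyc_rotate`) and Lawler's vertex local time `N(l;x)` (Def. 11) is `t.count x`. The weight
  is a parameter `r : ℝ≥0∞` per step (`r = 1/4` at the end). All statements are relative to a
  set `S` of deleted vertices (`Avoids S`), Lawler's `A_j = A ∖ {η_0,…,η_{j-1}}`.
* **Prop. 3.1** (`lesum_support`): `∑_{w : LE(w) = η, w ⊆ A∖S} r^{|w|} = lawlerF S η`, where
  `lawlerF S [a] = G_{A∖S}(a,a)` and `lawlerF S (a → c ⋯) = G_{A∖S}(a,a) · r · lawlerF (S∪{a}) (c ⋯)`
  (`green` = the diagonal Green's function), by induction on `η`; the inductive step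
  `lesum_cons` is the first-loop splitting at the last visit of `a`, implemented by the tree's
  bijection `splitLastEquiv a` (`RandomPlanarGeometry/LoopErasure.lean`) and `loopErase_cons`.
* **`G = 1/(1-f)`** (`green_eq_inv`): the loops at `x` with `N(l;x) = k` weigh `f_x^k`
  (`loopsWith_eq_pow`, splitting off the last excursion, again by `splitLastEquiv x`), and
  `∑_k f^k = (1-f)⁻¹` (`ENNReal.tsum_geometric`); integrability gives `f_x < 1`
  (`excursion_lt_one`).
* **Prop. 5.1** (`fiber_rotation`, `massThrough_eq_tsum_div_count`): for each length `n`,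
  `∑_{|l| = n, x ∈ l} q(l)/n = ∑_{|l| = n, l rooted at x} q(l)/N(l;x)`, by double counting the
  `n` rotations of each loop (`List.rotate_injective`, `getLast?_rotate_succ`,
  `cast_count_eq_sum_range`); then `= ∑_k f_x^k/k` (`tsum_div_count_eq`, `massThrough_eq_tsum_pow`).
* **Prop. 5.2(1)** (`toReal_green_eq_exp`): `toReal`, `Real.hasSum_pow_div_log_of_abs_lt_one`
  (`∑ f^{k+1}/(k+1) = -log(1-f)`) and `exp(-log(1-f)) = (1-f)⁻¹`.
* **Prop. 5.2(2)** (`massMeeting_cons`, `toReal_lawlerF`): the loops in `A∖S` meeting `{a} ∪ L`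
  are the loops through `a` plus the loops in `A∖(S∪{a})` meeting `L`; by induction on `η`,
  `lawlerF S η = r^{|η|} exp{m[ℒ(A∖S; η)]}` with everything finite.
* **Integrability** (`total_ne_top`): on `G ≤ ℤ²` with finitely many edges and `r = 1/4`, the
  row sums `Qⁿ(x, A)` (`pathsLen`) satisfy `Q^{n+1}(x,A) = ¼ ∑_{u ∼ x} Qⁿ(u,A)` (`pathsLen_succ`),
  `Qⁿ ≤ 1`, and the ESCAPE ESTIMATE `Q^N(x,A) ≤ 1 - 4^{-N}` (`pathsLen_add_pow_le_one`) because the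
  straight ray `x, x+e₀, x+2e₀, …` meets a non-edge of `G` within `N` = #(non-isolated
  vertices) + 1 steps (`exists_escape`, pigeonhole); sub-multiplicativity (`pathsLen_add_le`)
  then bounds `∑_n Qⁿ(x,A) ≤ N/(1-θ) < ∞` (`Nat.divModEquiv`, `ENNReal.tsum_geometric`).
* **Assembly** (`tsum_loopErase_eq_exp_rwLoopMass_holds`): the two sides of the fact are the
  `toReal`s of `lesum ∅ η` (`tsum_walk_ite_eq_lesum`, for the `DecidableEq` instance of the
  statement via `loopErase_eq_loopErase`) and of `massMeeting ∅ η`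
  (`tsum_sigma_walk_eq_massMeeting` with the tree's `tsum_ite_eq_rwLoopMass`).

Deviations from the printed proof: none in substance; Prop. 5.1 is proved by the elementary
double count of rotations rather than through irreducible loops (Lawler's `s_ℓ`), and the
integrability of the Type II weight on a finite-edge subgraph of `ℤ²` (asserted in §2 for finite
`A ⊂ ℤ^d`) is proved by the escape estimate above instead of Perron–Frobenius.
-/

open scoped ENNReal Classical
open Literature.Probability.RandomPlanarGeometry

namespace Literature.Probability.LatticeModels

namespace LoopErasedWalkIdentity

/-! ### List preliminaries -/

section ListFacts

variable {V : Type*}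

/-- The vertex list `a :: t` ends at `a` iff the tail `t` is empty or ends at `a`. [folklore] -/
theorem getLast_cons_eq_iff (a : V) (t : List V) :
    (a :: t).getLast (List.cons_ne_nil a t) = a ↔ (t = [] ∨ t.getLast? = some a) := by
  cases t with
  | nil => simp
  | cons b t' =>
    rw [List.getLast_cons (List.cons_ne_nil b t'),
      List.getLast?_eq_some_getLast (List.cons_ne_nil b t')]
    simp

/-- `(a :: t).getLast? = some a` iff `t = []` or `t` ends in `a`. [folklore] -/
theorem getLast?_cons_eq_some_iff (a : V) (t : List V) :
    (a :: t).getLast? = some a ↔ (t = [] ∨ t.getLast? = some a) := by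
  rw [List.getLast?_eq_some_getLast (List.cons_ne_nil a t), Option.some_inj, getLast_cons_eq_iff]

/-- `Avoids S t`: no vertex of the list `t` lies in `S` (a path in `A ∖ S`, Lawler's `A_j`).
[folklore] -/
def Avoids (S : Set V) (t : List V) : Prop := ∀ v ∈ t, v ∉ S

/-- The empty list avoids everything. [folklore] -/
@[simp] theorem avoids_nil (S : Set V) : Avoids S ([] : List V) := fun _ hv => by simp at hv

/-- `Avoids` on a cons. [folklore] -/
@[simp] theorem avoids_cons {S : Set V} {a : V} {t : List V} :
    Avoids S (a :: t) ↔ a ∉ S ∧ Avoids S t := by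
  simp [Avoids]

/-- `Avoids` on an append. [folklore] -/
@[simp] theorem avoids_append {S : Set V} {l₁ l₂ : List V} :
    Avoids S (l₁ ++ l₂) ↔ Avoids S l₁ ∧ Avoids S l₂ := by
  simp only [Avoids, List.mem_append]
  exact ⟨fun h => ⟨fun v hv => h v (Or.inl hv), fun v hv => h v (Or.inr hv)⟩,
    fun h v hv => hv.elim (h.1 v) (h.2 v)⟩

/-- Every list avoids the empty set. [folklore] -/
@[simp] theorem avoids_empty (t : List V) : Avoids (∅ : Set V) t := fun _ _ hv => hv

/-- Avoiding `insert a S` means avoiding `a` and avoiding `S`. [folklore] -/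
theorem avoids_insert {S : Set V} {a : V} {t : List V} :
    Avoids (insert a S) t ↔ a ∉ t ∧ Avoids S t := by
  simp only [Avoids, Set.mem_insert_iff, not_or]
  exact ⟨fun h => ⟨fun ha => (h a ha).1 rfl, fun v hv => (h v hv).2⟩,
    fun h v hv => ⟨fun hva => h.1 (hva ▸ hv), h.2 v hv⟩⟩

/-- `Avoids` is invariant under rotation. [folklore] -/
theorem avoids_rotate {S : Set V} {t : List V} (k : ℕ) : Avoids S (t.rotate k) ↔ Avoids S t := by
  simp [Avoids, List.mem_rotate]

/-- `IsCyc R t`: the nonempty list `t`, read as the rooted loop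
`t.getLast → t₀ → t₁ → ⋯ → t_{n-1} = t.getLast` (root = last entry, length `|t|`), has all its
steps in `R`. This is the "tail" encoding of a rooted loop of positive length (Lawler 2018, §2:
a loop rooted at `x` is an element of `𝒦_A(x,x)`), in which re-rooting at the next vertex is
`List.rotate · 1`. [folklore] -/
def IsCyc (R : V → V → Prop) (t : List V) : Prop :=
  ∃ x, t.getLast? = some x ∧ List.IsChain R (x :: t)

/-- A cyclic chain is nonempty. [folklore] -/
theorem IsCyc.ne_nil {R : V → V → Prop} {t : List V} (h : IsCyc R t) : t ≠ [] := by
  rintro rfl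
  obtain ⟨x, hx, -⟩ := h
  simp at hx

/-- `IsCyc` in terms of `getLast`. [folklore] -/
theorem isCyc_iff_getLast {R : V → V → Prop} {t : List V} (ht : t ≠ []) :
    IsCyc R t ↔ List.IsChain R (t.getLast ht :: t) := by
  rw [IsCyc, List.getLast?_eq_some_getLast ht]
  constructor
  · rintro ⟨x, hx, hc⟩
    rw [Option.some_inj] at hx
    rw [hx]
    exact hc
  · intro h
    exact ⟨_, rfl, h⟩

/-- `IsCyc` of a list with a given last element. [folklore] -/
theorem isCyc_iff_of_getLast? {R : V → V → Prop} {t : List V} {x : V} (hx : t.getLast? = some x) :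
    IsCyc R t ↔ List.IsChain R (x :: t) := by
  rw [IsCyc]
  constructor
  · rintro ⟨y, hy, hc⟩
    rw [hx, Option.some_inj] at hy
    rw [hy]
    exact hc
  · intro h
    exact ⟨x, hx, h⟩

/-- Re-rooting a loop at its next vertex keeps it a loop. [folklore] -/
theorem isCyc_rotate_one {R : V → V → Prop} (t : List V) : IsCyc R (t.rotate 1) ↔ IsCyc R t := by
  cases t with
  | nil => simp
  | cons v t' =>
    rw [List.rotate_cons_succ, List.rotate_zero,
      isCyc_iff_of_getLast? (x := v) (by simp), isCyc_iff_getLast (List.cons_ne_nil v t'),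
      List.isChain_cons_cons, ← List.cons_append, List.isChain_append]
    simp only [List.isChain_singleton, true_and, List.head?_cons, Option.mem_def,
      Option.some.injEq, forall_eq', List.getLast?_eq_some_getLast (List.cons_ne_nil v t')]
    exact and_comm

/-- Re-rooting a loop anywhere keeps it a loop. [folklore] -/
theorem isCyc_rotate {R : V → V → Prop} (t : List V) (k : ℕ) : IsCyc R (t.rotate k) ↔ IsCyc R t := by
  induction k with
  | zero => rw [List.rotate_zero]
  | succ k ih => rw [← List.rotate_rotate, isCyc_rotate_one, ih]

/-- The last entry of `t.rotate (i+1)` is `t[i]`. [folklore] -/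
theorem getLast?_rotate_succ {t : List V} {i : ℕ} (hi : i < t.length) :
    (t.rotate (i + 1)).getLast? = t[i]? := by
  have hne : t ≠ [] := by rintro rfl; simp at hi
  have hlen : 0 < t.length := List.length_pos_iff.2 hne
  rw [List.getLast?_eq_getElem?, List.length_rotate,
    List.getElem?_rotate (by omega)]
  congr 1
  have : t.length - 1 + (i + 1) = t.length + i := by omega
  rw [this, Nat.add_mod_left, Nat.mod_eq_of_lt hi]

/-- The number of occurrences of `x` in `t` (Lawler's vertex local time `N(l;x)`, Def. 11)
counted by positions, cast to `ℝ≥0∞`. [folklore] -/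
theorem cast_count_eq_sum_range (x : V) (t : List V) :
    ((t.count x : ℕ) : ℝ≥0∞) =
      ∑ i ∈ Finset.range t.length, if t[i]? = some x then (1 : ℝ≥0∞) else 0 := by
  induction t with
  | nil => simp
  | cons v t ih =>
    rw [List.length_cons, Finset.sum_range_succ', List.count_cons, Nat.cast_add, ih]
    simp only [List.getElem?_cons_succ, List.getElem?_cons_zero, Option.some.injEq]
    congr 1
    by_cases h : v = x
    · simp [h]
    · simp [h]

end ListFacts

/-! ### Reindexing sums over lists -/

section TsumFacts

variable {V : Type*}

/-- Changing the condition of an `if … then … else …` along an `↔`, for arbitrary `Decidable`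
instances. [folklore] -/
theorem ite_congr_prop {α : Sort*} {b c : Prop} {i : Decidable b} {j : Decidable c} (x y : α)
    (h : b ↔ c) : @ite α b i x y = @ite α c j x y := by
  by_cases hb : b
  · rw [if_pos hb, if_pos (h.1 hb)]
  · rw [if_neg hb, if_neg (mt h.2 hb)]

/-- A sum over lists supported on lists with head `a` is a sum over their tails. [folklore] -/
theorem tsum_eq_tsum_cons (a : V) (F : List V → ℝ≥0∞) (hF : ∀ w, F w ≠ 0 → w.head? = some a) :
    ∑' w, F w = ∑' t, F (a :: t) := by
  refine ((List.cons_injective (a := a)).tsum_eq fun w hw => ?_).symm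
  have h := hF w hw
  cases w with
  | nil => simp at h
  | cons b t =>
    simp only [List.head?_cons, Option.some.injEq] at h
    exact ⟨t, by rw [h]⟩

/-- A sum over lists vanishing at `[]` is a sum over (head, tail). [folklore] -/
theorem tsum_eq_tsum_prod_cons (F : List V → ℝ≥0∞) (hF : F [] = 0) :
    ∑' w, F w = ∑' p : V × List V, F (p.1 :: p.2) := by
  have hinj : Function.Injective (fun p : V × List V => p.1 :: p.2) := by
    rintro ⟨a, s⟩ ⟨b, t⟩ h
    simpa using h
  refine (hinj.tsum_eq (f := F) fun w hw => ?_).symm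
  cases w with
  | nil => exact absurd hF hw
  | cons b t => exact ⟨(b, t), rfl⟩

/-- A sum over lists supported on lists ending in `x` is a sum over `t ++ [x]`. [folklore] -/
theorem tsum_eq_tsum_concat (x : V) (F : List V → ℝ≥0∞)
    (hF : ∀ t, F t ≠ 0 → t.getLast? = some x) :
    ∑' t, F t = ∑' t, F (t ++ [x]) := by
  refine ((List.append_left_injective [x]).tsum_eq (f := F) fun t ht => ?_).symm
  exact ⟨t.dropLast, List.dropLast_append_getLast? x (hF t ht)⟩

/-- Reindexing a sum over lists by the last-occurrence splitting `splitLastEquiv a`.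
[folklore] -/
theorem tsum_eq_tsum_splitLast (a : V) (F : List V → ℝ≥0∞) :
    ∑' t, F t = ∑' p : {c : List V // c = [] ∨ c.getLast? = some a} × {ρ : List V // a ∉ ρ},
      F (p.1.1 ++ p.2.1) := by
  rw [← (splitLastEquiv a).symm.tsum_eq F]
  rfl

/-- A sum over a subtype as a sum with an indicator. [folklore] -/
theorem tsum_subtype_eq_tsum_ite {β : Type*} (p : β → Prop) (f : β → ℝ≥0∞) :
    ∑' x : {b // p b}, f x.1 = ∑' b, if p b then f b else 0 := by
  have h := tsum_subtype (f := f) {b | p b}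
  simp only [Set.indicator_apply, Set.mem_setOf_eq] at h
  exact h

/-- Summing by fibres of a map to `ℕ`. [folklore] -/
theorem tsum_eq_tsum_fiber {β : Type*} (F : β → ℝ≥0∞) (φ : β → ℕ) :
    ∑' b, F b = ∑' n, ∑' b, if φ b = n then F b else 0 := by
  rw [ENNReal.tsum_comm]
  refine tsum_congr fun b => ?_
  rw [tsum_ite_eq']

end TsumFacts

/-! ### The weighted path sums of a simple graph (Lawler 2018, §2–§3) -/

section Sums

variable {V : Type*} (G : SimpleGraph V) (r : ℝ≥0∞)

/-- `IsLoopAt G x t`: `x :: t` is the vertex list of a closed walk of `G` at `x` (a rooted loop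
at `x`, Lawler 2018 §2, the trivial loop being `t = []`); `t` is its list of vertices after the
root, `|t|` its length. [folklore] -/
def IsLoopAt (x : V) (t : List V) : Prop :=
  List.IsChain G.Adj (x :: t) ∧ (t = [] ∨ t.getLast? = some x)

/-- The Green's function at the diagonal of the walk killed outside `A ∖ S`:
`G_{A∖S}(x,x) = ∑_{l ∈ 𝒦_{A∖S}(x,x)} q(l)` with `q ≡ r` per step (Lawler 2018, §2), as a sum
over the tails `t` of the closed walks `x :: t`. [cite: Lawler2018, §2 (Green's function)] -/
def green (S : Set V) (x : V) : ℝ≥0∞ :=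
  ∑' t : List V, if IsLoopAt G x t ∧ Avoids S t then r ^ t.length else 0

/-- The total weight `∑_{ω from x} r^{|ω|}` of all walks of `G` from `x` (tails `t` of the
vertex lists `x :: t`). [folklore] -/
def total (x : V) : ℝ≥0∞ :=
  ∑' t : List V, if List.IsChain G.Adj (x :: t) then r ^ t.length else 0

/-- The loop-erased measure `q̂(η) = ∑_{ω : LE(ω) = η} q(ω)` (Lawler 2018, §3 Def. 2) of the walks
in `A ∖ S`, as a function of the vertex list `L = η`: the sum of `r^{|w|-1}` over the vertex
lists `w` (chains of `G` avoiding `S`) whose chronological loop erasure is `L`.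
[cite: Lawler2018, §3 Definition 2] -/
def lesum (S : Set V) (L : List V) : ℝ≥0∞ :=
  ∑' w : List V,
    if List.IsChain G.Adj w ∧ Avoids S w ∧ loopErase w = L then r ^ (w.length - 1) else 0

/-- Lawler's right-hand side `q(η) ∏_{j=0}^{m} G_{A_j}(η_j, η_j)`, `A_j = A ∖ (S ∪ {η_0,…,η_{j-1}})`
(Lawler 2018, Prop. 3.1), defined by recursion along `η`. [cite: Lawler2018, Proposition 3.1] -/
def lawlerF : Set V → ∀ {a b : V}, G.Walk a b → ℝ≥0∞
  | S, a, _, SimpleGraph.Walk.nil => green G r S a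
  | S, a, _, SimpleGraph.Walk.cons _ η' => green G r S a * r * lawlerF (insert a S) η'

/-- The loop measure of the loops in `A ∖ S` through `x`:
`m[ℒ(A∖S; x)] = ∑_{l rooted, |l| ≥ 1, x ∈ l} q(l)/|l|` (Lawler 2018, Def. 8–10), rooted loops in
the tail encoding `IsCyc`. [cite: Lawler2018, Definition 8 and Definition 10] -/
def massThrough (S : Set V) (x : V) : ℝ≥0∞ :=
  ∑' t : List V, if IsCyc G.Adj t ∧ Avoids S t ∧ x ∈ t then r ^ t.length / t.length else 0

/-- The loop measure of the loops in `A ∖ S` meeting `W`: `m[ℒ(A∖S; W)]` (Lawler 2018,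
Def. 9–10). [cite: Lawler2018, Definition 10] -/
def massMeeting (S : Set V) (W : Set V) : ℝ≥0∞ :=
  ∑' t : List V,
    if IsCyc G.Adj t ∧ Avoids S t ∧ (∃ v ∈ t, v ∈ W) then r ^ t.length / t.length else 0

variable {G r}

/-- `lawlerF` of the trivial path. [folklore] -/
@[simp] theorem lawlerF_nil (S : Set V) (a : V) :
    lawlerF G r S (SimpleGraph.Walk.nil : G.Walk a a) = green G r S a := rfl

/-- `lawlerF` of a path with a first step. [folklore] -/
@[simp] theorem lawlerF_cons (S : Set V) {a c b : V} (h : G.Adj a c) (η' : G.Walk c b) :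
    lawlerF G r S (SimpleGraph.Walk.cons h η') = green G r S a * r * lawlerF G r (insert a S) η' :=
  rfl

/-! ### Proposition 3.1: the loop decomposition of `{ω : LE(ω) = η}` -/

/-- The walks whose loop erasure is the one-point path `[a]` are exactly the closed walks at
`a`, so `q̂([a]) = G_{A∖S}(a,a)`. [cite: Lawler2018, Proposition 3.1 (m = 0)] -/
theorem lesum_singleton {S : Set V} {a : V} (ha : a ∉ S) : lesum G r S [a] = green G r S a := by
  unfold lesum green
  rw [tsum_eq_tsum_cons a]
  · refine tsum_congr fun t => ?_
    have key : (List.IsChain G.Adj (a :: t) ∧ Avoids S (a :: t) ∧ loopErase (a :: t) = [a]) ↔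
        (IsLoopAt G a t ∧ Avoids S t) := by
      constructor
      · rintro ⟨hc, hav, hle⟩
        refine ⟨⟨hc, ?_⟩, (avoids_cons.1 hav).2⟩
        have h1 := getLast?_loopErase (a :: t)
        rw [hle] at h1
        exact (getLast?_cons_eq_some_iff a t).1 h1.symm
      · rintro ⟨⟨hc, hlast⟩, hav⟩
        refine ⟨hc, avoids_cons.2 ⟨ha, hav⟩, ?_⟩
        exact loopErase_eq_singleton_of_head_eq_getLast a t ((getLast_cons_eq_iff a t).2 hlast)
    rw [if_congr key rfl rfl]
    simp
  · intro w hw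
    rw [Ne, ite_eq_right_iff, Classical.not_imp] at hw
    have h1 := head?_loopErase w
    rw [hw.1.2.2] at h1
    exact h1.symm

/-- **The first loop of the decomposition** (Lawler 2018, proof of Prop. 3.1): splitting a walk
`ω` with `LE(ω) = [a, η_1, …]` at its last visit to `a` gives `ω = l_0 ⊕ [a, η_1] ⊕ ω'` with
`l_0` a loop at `a` in `A ∖ S` and `ω'` a walk in `A ∖ (S ∪ {a})` with `LE(ω') = [η_1, …]`,
bijectively, and `q(ω) = q(l_0) q([a,η_1]) q(ω')`; hence
`q̂_S(a :: L) = G_{A∖S}(a,a) · r · q̂_{S ∪ {a}}(L)`. [cite: Lawler2018, Proposition 3.1 (proof)] -/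
theorem lesum_cons {S : Set V} {a : V} (ha : a ∉ S) {L : List V} (hL : L ≠ [])
    (hadj : ∀ c ∈ L.head?, G.Adj a c) :
    lesum G r S (a :: L) = green G r S a * r * lesum G r (insert a S) L := by
  have hLE : ∀ ρ : List V, loopErase ρ = L → ρ ≠ [] ∧ ∀ c ∈ ρ.head?, G.Adj a c := by
    intro ρ hρ
    have hne : ρ ≠ [] := by
      rintro rfl
      exact hL (by simpa using hρ.symm)
    refine ⟨hne, fun c hc => hadj c ?_⟩
    rw [← hρ, head?_loopErase]
    exact hc
  rw [lesum]
  rw [tsum_eq_tsum_cons a]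
  swap
  · intro w hw
    rw [Ne, ite_eq_right_iff, Classical.not_imp] at hw
    have h1 := head?_loopErase w
    rw [hw.1.2.2] at h1
    exact h1.symm
  -- Step 1: rewrite the summand in terms of `afterLast a t`.
  have step1 : ∀ t : List V,
      (if List.IsChain G.Adj (a :: t) ∧ Avoids S (a :: t) ∧ loopErase (a :: t) = a :: L then
          r ^ ((a :: t).length - 1) else 0) =
        if List.IsChain G.Adj (a :: t) ∧ Avoids S t ∧ loopErase (afterLast a t) = L then
          r ^ t.length else 0 := by
    intro t
    have key : (List.IsChain G.Adj (a :: t) ∧ Avoids S (a :: t) ∧ loopErase (a :: t) = a :: L) ↔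
        (List.IsChain G.Adj (a :: t) ∧ Avoids S t ∧ loopErase (afterLast a t) = L) := by
      rw [loopErase_cons, List.cons_eq_cons, avoids_cons]
      tauto
    rw [if_congr key rfl rfl]
    simp
  simp_rw [step1]
  -- Step 2: reindex by the last-occurrence splitting and factor.
  rw [tsum_eq_tsum_splitLast a]
  have step2 : ∀ p : {c : List V // c = [] ∨ c.getLast? = some a} × {ρ : List V // a ∉ ρ},
      (if List.IsChain G.Adj (a :: (p.1.1 ++ p.2.1)) ∧ Avoids S (p.1.1 ++ p.2.1) ∧
            loopErase (afterLast a (p.1.1 ++ p.2.1)) = L then r ^ (p.1.1 ++ p.2.1).length else 0) =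
        (if List.IsChain G.Adj (a :: p.1.1) ∧ Avoids S p.1.1 then r ^ p.1.1.length else 0) *
          (if List.IsChain G.Adj (a :: p.2.1) ∧ Avoids S p.2.1 ∧ loopErase p.2.1 = L then
            r ^ p.2.1.length else 0) := by
    rintro ⟨⟨c, hc⟩, ⟨ρ, hρ⟩⟩
    simp only
    rw [afterLast_append_of hc hρ]
    have hchain : List.IsChain G.Adj (a :: (c ++ ρ)) ↔
        List.IsChain G.Adj (a :: c) ∧ List.IsChain G.Adj (a :: ρ) := by
      rw [← List.cons_append, List.isChain_append, List.isChain_cons (l := ρ)]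
      have hl : (a :: c).getLast? = some a := (getLast?_cons_eq_some_iff a c).2 hc
      simp [hl, and_comm]
    by_cases h1 : List.IsChain G.Adj (a :: c) ∧ Avoids S c
    · by_cases h2 : List.IsChain G.Adj (a :: ρ) ∧ Avoids S ρ ∧ loopErase ρ = L
      · rw [if_pos h1, if_pos h2, if_pos ⟨hchain.2 ⟨h1.1, h2.1⟩, avoids_append.2 ⟨h1.2, h2.2.1⟩,
          h2.2.2⟩, List.length_append, pow_add]
      · rw [if_neg h2, mul_zero, if_neg]
        rintro ⟨hc', hav, hle⟩
        exact h2 ⟨(hchain.1 hc').2, (avoids_append.1 hav).2, hle⟩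
    · rw [if_neg h1, zero_mul, if_neg]
      rintro ⟨hc', hav, -⟩
      exact h1 ⟨(hchain.1 hc').1, (avoids_append.1 hav).1⟩
  simp_rw [step2]
  rw [ENNReal.tsum_prod']
  simp_rw [ENNReal.tsum_mul_left]
  rw [ENNReal.tsum_mul_right]
  -- Step 3: identify the two factors.
  have fac1 : (∑' c : {c : List V // c = [] ∨ c.getLast? = some a},
      (if List.IsChain G.Adj (a :: c.1) ∧ Avoids S c.1 then r ^ c.1.length else 0)) =
      green G r S a := by
    rw [tsum_subtype_eq_tsum_ite (fun c : List V => c = [] ∨ c.getLast? = some a)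
      (fun c : List V => if List.IsChain G.Adj (a :: c) ∧ Avoids S c then r ^ c.length else 0)]
    unfold green
    refine tsum_congr fun c => ?_
    by_cases hc : c = [] ∨ c.getLast? = some a
    · rw [if_pos hc]
      refine ite_congr_prop _ _ ?_
      simp [IsLoopAt, hc]
    · rw [if_neg hc, if_neg]
      rintro ⟨⟨-, h⟩, -⟩
      exact hc h
  have fac2 : (∑' ρ : {ρ : List V // a ∉ ρ},
      (if List.IsChain G.Adj (a :: ρ.1) ∧ Avoids S ρ.1 ∧ loopErase ρ.1 = L then
        r ^ ρ.1.length else 0)) = r * lesum G r (insert a S) L := by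
    rw [tsum_subtype_eq_tsum_ite (fun ρ : List V => a ∉ ρ)
      (fun ρ : List V => if List.IsChain G.Adj (a :: ρ) ∧ Avoids S ρ ∧ loopErase ρ = L then
        r ^ ρ.length else 0)]
    unfold lesum
    rw [← ENNReal.tsum_mul_left]
    refine tsum_congr fun ρ => ?_
    by_cases hle : loopErase ρ = L
    · obtain ⟨hne, hadjρ⟩ := hLE ρ hle
      have hlen : ρ.length = ρ.length - 1 + 1 :=
        (Nat.sub_add_cancel (List.length_pos_iff.2 hne)).symm
      have hch : List.IsChain G.Adj (a :: ρ) ↔ List.IsChain G.Adj ρ := by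
        rw [List.isChain_cons]
        exact ⟨fun h => h.2, fun h => ⟨hadjρ, h⟩⟩
      by_cases hρ : a ∉ ρ ∧ List.IsChain G.Adj ρ ∧ Avoids S ρ
      · rw [if_pos hρ.1, if_pos ⟨hch.2 hρ.2.1, hρ.2.2, hle⟩,
          if_pos ⟨hρ.2.1, avoids_insert.2 ⟨hρ.1, hρ.2.2⟩, hle⟩]
        conv_lhs => rw [hlen, pow_succ']
      · have hρ' : ¬ (List.IsChain G.Adj ρ ∧ Avoids (insert a S) ρ ∧ loopErase ρ = L) := by
          rintro ⟨h1, h2, -⟩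
          exact hρ ⟨(avoids_insert.1 h2).1, h1, (avoids_insert.1 h2).2⟩
        rw [if_neg hρ', mul_zero]
        by_cases haρ : a ∉ ρ
        · rw [if_pos haρ, if_neg]
          rintro ⟨h1, h2, -⟩
          exact hρ ⟨haρ, hch.1 h1, h2⟩
        · rw [if_neg haρ]
    · have h1 : ¬ (List.IsChain G.Adj (a :: ρ) ∧ Avoids S ρ ∧ loopErase ρ = L) :=
        fun h => hle h.2.2
      have h2 : ¬ (List.IsChain G.Adj ρ ∧ Avoids (insert a S) ρ ∧ loopErase ρ = L) :=
        fun h => hle h.2.2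
      rw [if_neg h2, mul_zero]
      simp [h1]
  rw [fac1, fac2, mul_assoc]

/-- **Lawler 2018, Proposition 3.1** (`q̂(η) = q(η) ∏_j G_{A_j}(η_j,η_j)`), in `A ∖ S` and in the
recursive form `lawlerF`: for a self-avoiding `η` avoiding `S`,
`∑_{w : LE(w) = η, w ⊆ A∖S} r^{|w|} = lawlerF S η`. [cite: Lawler2018, Proposition 3.1] -/
theorem lesum_support {S : Set V} {a b : V} (η : G.Walk a b) (hη : η.IsPath)
    (hS : Avoids S η.support) : lesum G r S η.support = lawlerF G r S η := by
  induction η generalizing S with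
  | nil =>
    rw [SimpleGraph.Walk.support_nil, lawlerF_nil]
    exact lesum_singleton (by simpa using hS)
  | cons h η' ih =>
    rename_i a c b
    rw [SimpleGraph.Walk.support_cons, lawlerF_cons]
    rw [SimpleGraph.Walk.cons_isPath_iff] at hη
    rw [SimpleGraph.Walk.support_cons, avoids_cons] at hS
    rw [lesum_cons hS.1 (SimpleGraph.Walk.support_ne_nil η') ?_, ih hη.1]
    · exact avoids_insert.2 ⟨hη.2, hS.2⟩
    · intro c' hc'
      have h1 : η'.support.head? = some c := by
        rw [List.head?_eq_some_head (SimpleGraph.Walk.support_ne_nil η'),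
          SimpleGraph.Walk.head_support]
      rw [h1] at hc'
      simp only [Option.mem_def, Option.some.injEq] at hc'
      rw [← hc']
      exact h

end Sums

/-! ### Proposition 5.2 (first part): `G_A(x,x) = exp m[ℒ(A;x)]` -/

section LoopMeasure

variable {V : Type*} (G : SimpleGraph V) (r : ℝ≥0∞)

/-- Splitting a chain `x :: (c ++ m)` at a return to `x`: if `x :: c` ends at `x`, the chain
condition splits into those of `x :: c` and `x :: m`. [folklore] -/
theorem isChain_cons_append_iff {R : V → V → Prop} {x : V} {c m : List V}
    (hc : c = [] ∨ c.getLast? = some x) :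
    List.IsChain R (x :: (c ++ m)) ↔ List.IsChain R (x :: c) ∧ List.IsChain R (x :: m) := by
  rw [← List.cons_append, List.isChain_append, List.isChain_cons (l := m)]
  have hl : (x :: c).getLast? = some x := (getLast?_cons_eq_some_iff x c).2 hc
  simp [hl, and_comm]

/-- `q[𝒦̃^k_x]`: the weight of the loops at `x` in `A ∖ S` visiting `x` exactly `k` times after
time `0` (Lawler 2018, §5.1: `𝒦̃_x^k(A)`, vertex local time `N(l;x) = k`, Def. 11), in the tail
encoding (`t.count x = k`). [cite: Lawler2018, §5.1 (display before Definition 8)] -/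
def loopsWith (S : Set V) (x : V) (k : ℕ) : ℝ≥0∞ :=
  ∑' t : List V, if IsLoopAt G x t ∧ Avoids S t ∧ t.count x = k then r ^ t.length else 0

/-- `f_x = ∑_{l ∈ 𝒦̃¹_x} q(l)`: the weight of the elementary loops (excursions) at `x` in
`A ∖ S` — closed walks `x, ρ, x` of positive length whose interior `ρ` avoids `x`
(Lawler 2018, §2 and §5.1, eq. (dec28.3)). [cite: Lawler2018, §5.1 (elementary loops, f_x)] -/
def excursion (S : Set V) (x : V) : ℝ≥0∞ :=
  ∑' ρ : List V,
    if List.IsChain G.Adj (x :: (ρ ++ [x])) ∧ Avoids S ρ ∧ x ∉ ρ then r ^ (ρ.length + 1) else 0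

variable {G r}

/-- A nontrivial closed walk at `x` ends at `x`. [folklore] -/
theorem IsLoopAt.getLast? {x : V} {t : List V} (h : IsLoopAt G x t) (ht : t ≠ []) :
    t.getLast? = some x :=
  h.2.resolve_left ht

/-- `G_{A∖S}(x,x) ≤ ∑_{ω from x} q(ω)`. [folklore] -/
theorem green_le_total (S : Set V) (x : V) : green G r S x ≤ total G r x := by
  unfold green total
  refine ENNReal.tsum_le_tsum fun t => ?_
  split_ifs with h1 h2
  · exact le_rfl
  · exact absurd h1.1.1 h2
  · exact bot_le
  · exact le_rfl

/-- `q[𝒦̃⁰_x] = 1`: only the trivial loop never returns to `x`. [cite: Lawler2018, §5.1] -/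
theorem loopsWith_zero (S : Set V) (x : V) : loopsWith G r S x 0 = 1 := by
  unfold loopsWith
  rw [tsum_eq_single ([] : List V)]
  · simp [IsLoopAt]
  · intro t ht
    rw [if_neg]
    rintro ⟨⟨-, hlast⟩, -, hcount⟩
    rcases hlast with rfl | hlast
    · exact ht rfl
    · exact (List.count_pos_iff.2 (List.mem_of_getLast? hlast)).ne' hcount

/-- **`q[𝒦̃^{k+1}_x] = q[𝒦̃^k_x] · f_x`**: splitting off the last excursion,
`l = l' ⊕ l^{k+1}` uniquely (Lawler 2018, §5.1, eq. (dec28.2): `l = l¹ ⊕ ⋯ ⊕ l^k` with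
`l^i ∈ 𝒦̃¹_x`). [cite: Lawler2018, §5.1 (eq. dec28.2)] -/
theorem loopsWith_succ {S : Set V} {x : V} (hx : x ∉ S) (k : ℕ) :
    loopsWith G r S x (k + 1) = loopsWith G r S x k * excursion G r S x := by
  rw [loopsWith]
  rw [tsum_eq_tsum_concat x]
  swap
  · intro t ht
    rw [Ne, ite_eq_right_iff, Classical.not_imp] at ht
    obtain ⟨⟨hl, -, hcount⟩, -⟩ := ht
    refine hl.getLast? ?_
    rintro rfl
    simp at hcount
  rw [tsum_eq_tsum_splitLast x]
  have step : ∀ p : {c : List V // c = [] ∨ c.getLast? = some x} × {ρ : List V // x ∉ ρ},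
      (if IsLoopAt G x (p.1.1 ++ p.2.1 ++ [x]) ∧ Avoids S (p.1.1 ++ p.2.1 ++ [x]) ∧
            (p.1.1 ++ p.2.1 ++ [x]).count x = k + 1 then
          r ^ (p.1.1 ++ p.2.1 ++ [x]).length else 0) =
        (if IsLoopAt G x p.1.1 ∧ Avoids S p.1.1 ∧ p.1.1.count x = k then
            r ^ p.1.1.length else 0) *
          (if List.IsChain G.Adj (x :: (p.2.1 ++ [x])) ∧ Avoids S p.2.1 then
            r ^ (p.2.1.length + 1) else 0) := by
    rintro ⟨⟨c, hc⟩, ⟨ρ, hρ⟩⟩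
    simp only
    have hchain : IsLoopAt G x (c ++ ρ ++ [x]) ↔
        List.IsChain G.Adj (x :: c) ∧ List.IsChain G.Adj (x :: (ρ ++ [x])) := by
      rw [IsLoopAt, List.append_assoc, isChain_cons_append_iff hc]
      simp
    have hcount : (c ++ ρ ++ [x]).count x = c.count x + 1 := by
      rw [List.count_append, List.count_append, List.count_eq_zero.2 hρ]
      simp
    have hav : Avoids S (c ++ ρ ++ [x]) ↔ Avoids S c ∧ Avoids S ρ := by
      simp [hx]
    have hlen : (c ++ ρ ++ [x]).length = c.length + (ρ.length + 1) := by
      simp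
    have hloop : IsLoopAt G x c ↔ List.IsChain G.Adj (x :: c) := by
      simp [IsLoopAt, hc]
    by_cases h1 : IsLoopAt G x c ∧ Avoids S c ∧ c.count x = k
    · by_cases h2 : List.IsChain G.Adj (x :: (ρ ++ [x])) ∧ Avoids S ρ
      · rw [if_pos h1, if_pos h2, if_pos, hlen, pow_add]
        exact ⟨hchain.2 ⟨hloop.1 h1.1, h2.1⟩, hav.2 ⟨h1.2.1, h2.2⟩, by rw [hcount, h1.2.2]⟩
      · rw [if_neg h2, mul_zero, if_neg]
        rintro ⟨hl, hv, -⟩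
        exact h2 ⟨(hchain.1 hl).2, (hav.1 hv).2⟩
    · rw [if_neg h1, zero_mul, if_neg]
      rintro ⟨hl, hv, hk⟩
      refine h1 ⟨hloop.2 (hchain.1 hl).1, (hav.1 hv).1, ?_⟩
      rw [hcount] at hk
      omega
  simp_rw [step]
  rw [ENNReal.tsum_prod']
  simp_rw [ENNReal.tsum_mul_left]
  rw [ENNReal.tsum_mul_right]
  congr 1
  · rw [tsum_subtype_eq_tsum_ite (fun c : List V => c = [] ∨ c.getLast? = some x)
      (fun c : List V => if IsLoopAt G x c ∧ Avoids S c ∧ c.count x = k then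
        r ^ c.length else 0)]
    unfold loopsWith
    refine tsum_congr fun c => ?_
    by_cases hc : c = [] ∨ c.getLast? = some x
    · rw [if_pos hc]
    · rw [if_neg hc, if_neg]
      rintro ⟨⟨-, h⟩, -⟩
      exact hc h
  · rw [tsum_subtype_eq_tsum_ite (fun ρ : List V => x ∉ ρ)
      (fun ρ : List V => if List.IsChain G.Adj (x :: (ρ ++ [x])) ∧ Avoids S ρ then
        r ^ (ρ.length + 1) else 0)]
    unfold excursion
    refine tsum_congr fun ρ => ?_
    by_cases hρ : x ∉ ρ
    · rw [if_pos hρ]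
      refine ite_congr_prop _ _ ?_
      simp [hρ]
    · rw [if_neg hρ, if_neg]
      rintro ⟨-, -, h⟩
      exact hρ h

/-- `q[𝒦̃^k_x] = f_x^k` (Lawler 2018, §5.1: "Note that `q(𝒦̃^k_x) = f_x^k`").
[cite: Lawler2018, §5.1] -/
theorem loopsWith_eq_pow {S : Set V} {x : V} (hx : x ∉ S) (k : ℕ) :
    loopsWith G r S x k = excursion G r S x ^ k := by
  induction k with
  | zero => rw [pow_zero, loopsWith_zero]
  | succ k ih => rw [loopsWith_succ hx, ih, pow_succ]

/-- `G_{A∖S}(x,x) = ∑_k q[𝒦̃^k_x]` (the partition `𝒦_A(x,x) = ⋃_k 𝒦̃^k_x(A)`, Lawler 2018, §5.1).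
[cite: Lawler2018, §5.1] -/
theorem green_eq_tsum_loopsWith (S : Set V) (x : V) :
    green G r S x = ∑' k, loopsWith G r S x k := by
  unfold green loopsWith
  rw [tsum_eq_tsum_fiber _ (fun t : List V => t.count x)]
  refine tsum_congr fun k => tsum_congr fun t => ?_
  by_cases h : t.count x = k <;> simp [h]

/-- **`G_A(x,x) = 1/(1 - f_x)`** (Lawler 2018, §2, eq. (nov17.1); §5.1, eq. (dec28.3)), in `ℝ≥0∞`.
[cite: Lawler2018, §2 (eq. nov17.1)] -/
theorem green_eq_inv {S : Set V} {x : V} (hx : x ∉ S) :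
    green G r S x = (1 - excursion G r S x)⁻¹ := by
  rw [green_eq_tsum_loopsWith]
  simp_rw [loopsWith_eq_pow hx]
  exact ENNReal.tsum_geometric _

/-- For an integrable weight, `f_x < 1`. [cite: Lawler2018, §2 (integrable weights)] -/
theorem excursion_lt_one {S : Set V} {x : V} (hx : x ∉ S) (hg : green G r S x ≠ ⊤) :
    excursion G r S x < 1 := by
  rw [green_eq_inv hx, ENNReal.inv_ne_top] at hg
  exact tsub_pos_iff_lt.1 (pos_iff_ne_zero.2 hg)

/-! ### Proposition 5.1: forgetting the root -/

/-- `n · (a / (n c)) = a / c` in `ℝ≥0∞` for `0 < n < ∞`. [folklore] -/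
theorem ENNReal.natMul_div_mul {n c a : ℝ≥0∞} (hn0 : n ≠ 0) (hnT : n ≠ ⊤) :
    n * (a / (n * c)) = a / c := by
  rw [ENNReal.div_eq_inv_mul, ENNReal.div_eq_inv_mul, ENNReal.mul_inv (Or.inl hn0) (Or.inl hnT)]
  calc n * (n⁻¹ * c⁻¹ * a) = (n * n⁻¹) * (c⁻¹ * a) := by ring
    _ = c⁻¹ * a := by rw [ENNReal.mul_inv_cancel hn0 hnT, one_mul]

/-- `(a / (n c)) · c = a / n` in `ℝ≥0∞` for `0 < c < ∞`. [folklore] -/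
theorem ENNReal.div_mul_mul_cancel {n c a : ℝ≥0∞} (hc0 : c ≠ 0) (hcT : c ≠ ⊤) :
    a / (n * c) * c = a / n := by
  rw [ENNReal.div_eq_inv_mul, ENNReal.div_eq_inv_mul, ENNReal.mul_inv (Or.inr hcT) (Or.inr hc0)]
  calc n⁻¹ * c⁻¹ * a * c = (c⁻¹ * c) * (n⁻¹ * a) := by ring
    _ = n⁻¹ * a := by rw [ENNReal.inv_mul_cancel hc0 hcT, one_mul]

/-- **Proposition 5.1 of Lawler 2018 (one length at a time)**: the rooted loop measure
`q(l)/|l|` summed over the rooted loops of length `n` through `x` equals `q(l)/N(l;x)` summed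
over the loops of length `n` rooted at `x` — proved by double counting the `n` rotations of each
loop (`N(l;x)` of which are rooted at `x`). [cite: Lawler2018, Proposition 5.1] -/
theorem fiber_rotation (S : Set V) (x : V) {n : ℕ} (hn : 0 < n) :
    (∑' t : List V, if t.length = n then
        (if IsCyc G.Adj t ∧ Avoids S t ∧ x ∈ t then r ^ t.length / t.length else 0) else 0) =
    ∑' t : List V, if t.length = n then
        (if IsLoopAt G x t ∧ Avoids S t ∧ t ≠ [] then r ^ t.length / t.count x else 0) else 0 := by
  have hn0 : (n : ℝ≥0∞) ≠ 0 := Nat.cast_ne_zero.2 hn.ne'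
  have hnT : (n : ℝ≥0∞) ≠ ⊤ := ENNReal.natCast_ne_top n
  -- (1) the right-hand side, with a factor `n` written as a sum over `Finset.range n`
  have e1 : ∀ t : List V, (if t.length = n then
        (if IsLoopAt G x t ∧ Avoids S t ∧ t ≠ [] then r ^ t.length / t.count x else 0) else 0) =
      ∑ i ∈ Finset.range n,
        if (t.length = n ∧ IsCyc G.Adj t ∧ Avoids S t) ∧ t.getLast? = some x then
          r ^ n / ((n : ℝ≥0∞) * t.count x) else 0 := by
    intro t
    rw [Finset.sum_const, Finset.card_range, nsmul_eq_mul]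
    by_cases hlen : t.length = n
    · rw [if_pos hlen]
      have hne : t ≠ [] := by
        rintro rfl
        rw [List.length_nil] at hlen
        omega
      by_cases hc : IsCyc G.Adj t ∧ Avoids S t ∧ t.getLast? = some x
      · have hl : IsLoopAt G x t := ⟨(isCyc_iff_of_getLast? hc.2.2).1 hc.1, Or.inr hc.2.2⟩
        rw [if_pos ⟨hl, hc.2.1, hne⟩, if_pos ⟨⟨hlen, hc.1, hc.2.1⟩, hc.2.2⟩, hlen,
          ENNReal.natMul_div_mul hn0 hnT]
      · rw [if_neg, if_neg, mul_zero]
        · rintro ⟨⟨-, h1, h2⟩, h3⟩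
          exact hc ⟨h1, h2, h3⟩
        · rintro ⟨hl, hav, -⟩
          exact hc ⟨(isCyc_iff_of_getLast? (hl.getLast? hne)).2 hl.1, hav, hl.getLast? hne⟩
    · rw [if_neg hlen, if_neg, mul_zero]
      rintro ⟨⟨h, -⟩, -⟩
      exact hlen h
  -- (2) the left-hand side, with `N(l;x)` written as a sum over the positions of `x`
  have e2 : ∀ t : List V, (if t.length = n then
        (if IsCyc G.Adj t ∧ Avoids S t ∧ x ∈ t then r ^ t.length / t.length else 0) else 0) =
      ∑ i ∈ Finset.range n,
        if (t.length = n ∧ IsCyc G.Adj t ∧ Avoids S t) ∧ t[i]? = some x then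
          r ^ n / ((n : ℝ≥0∞) * t.count x) else 0 := by
    intro t
    by_cases hT : t.length = n ∧ IsCyc G.Adj t ∧ Avoids S t
    · obtain ⟨hlen, hcyc, hav⟩ := hT
      rw [if_pos hlen]
      have hsum : (∑ i ∈ Finset.range n,
          if (t.length = n ∧ IsCyc G.Adj t ∧ Avoids S t) ∧ t[i]? = some x then
            r ^ n / ((n : ℝ≥0∞) * t.count x) else 0) =
          r ^ n / ((n : ℝ≥0∞) * t.count x) * t.count x := by
        have hcast : ((t.count x : ℕ) : ℝ≥0∞) =
            ∑ i ∈ Finset.range n, if t[i]? = some x then (1 : ℝ≥0∞) else 0 := by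
          rw [cast_count_eq_sum_range x t, hlen]
        conv_rhs => arg 2; rw [hcast]
        rw [Finset.mul_sum]
        refine Finset.sum_congr rfl fun i _ => ?_
        by_cases hi : t[i]? = some x
        · rw [if_pos ⟨⟨hlen, hcyc, hav⟩, hi⟩, if_pos hi, mul_one]
        · rw [if_neg (fun h => hi h.2), if_neg hi, mul_zero]
      rw [hsum]
      by_cases hxt : x ∈ t
      · have hc0 : (t.count x : ℝ≥0∞) ≠ 0 := by
          rw [Nat.cast_ne_zero]
          exact (List.count_pos_iff.2 hxt).ne'
        rw [if_pos ⟨hcyc, hav, hxt⟩, hlen,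
          ENNReal.div_mul_mul_cancel hc0 (ENNReal.natCast_ne_top _)]
      · rw [if_neg (fun h => hxt h.2.2), List.count_eq_zero.2 hxt, Nat.cast_zero, mul_zero]
    · rw [Finset.sum_eq_zero (fun i _ => if_neg (fun h => hT h.1))]
      by_cases hlen : t.length = n
      · rw [if_pos hlen, if_neg]
        rintro ⟨h1, h2, -⟩
        exact hT ⟨hlen, h1, h2⟩
      · rw [if_neg hlen]
  simp_rw [e1, e2]
  rw [Summable.tsum_finsetSum (fun i _ => ENNReal.summable),
    Summable.tsum_finsetSum (fun i _ => ENNReal.summable)]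
  refine Finset.sum_congr rfl fun i hi => ?_
  rw [Finset.mem_range] at hi
  -- (3) re-rooting: rotate by `i + 1`
  symm
  rw [← (List.rotate_injective (i + 1)).tsum_eq
    (f := fun t : List V => if (t.length = n ∧ IsCyc G.Adj t ∧ Avoids S t) ∧ t.getLast? = some x
      then r ^ n / ((n : ℝ≥0∞) * t.count x) else 0)
    (fun t _ => ⟨t.rotate (t.length - (i + 1) % t.length), List.rotate_eq_iff.2 rfl⟩)]
  refine tsum_congr fun t => ?_
  simp only [List.length_rotate, isCyc_rotate, avoids_rotate,
    (List.rotate_perm t (i + 1)).count_eq]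
  by_cases hlen : t.length = n
  · rw [getLast?_rotate_succ (by omega)]
  · simp [hlen]

/-- **Proposition 5.1 of Lawler 2018** for the loops avoiding `S` through `x`: the loop measure
`m[ℒ(A∖S; x)] = ∑_{l through x} q(l)/|l|` equals `∑_{l rooted at x, |l| ≥ 1} q(l)/N(l;x)`.
[cite: Lawler2018, Proposition 5.1] -/
theorem massThrough_eq_tsum_div_count (S : Set V) (x : V) :
    massThrough G r S x =
      ∑' t : List V, if IsLoopAt G x t ∧ Avoids S t ∧ t ≠ [] then
        r ^ t.length / t.count x else 0 := by
  unfold massThrough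
  rw [tsum_eq_tsum_fiber _ List.length,
    tsum_eq_tsum_fiber (fun t : List V => if IsLoopAt G x t ∧ Avoids S t ∧ t ≠ [] then
      r ^ t.length / t.count x else 0) List.length]
  refine tsum_congr fun n => ?_
  rcases Nat.eq_zero_or_pos n with rfl | hn
  · refine tsum_congr fun t => ?_
    by_cases ht : t.length = 0
    · have h0 : t = [] := List.eq_nil_of_length_eq_zero ht
      subst h0
      simp [IsCyc]
    · simp [ht]
  · exact fiber_rotation S x hn

/-- `∑_{l at x, |l| ≥ 1} q(l)/N(l;x) = ∑_{k ≥ 1} k⁻¹ q[𝒦̃^k_x]` (Lawler 2018, Prop. 5.1: the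
measure `m'` gives `q(l)/N(l;x)` to `l ∈ 𝒦̃_x`, `m'(V) = ∑_k k⁻¹ q[V ∩ 𝒦̃^k_x]`).
[cite: Lawler2018, Proposition 5.1] -/
theorem tsum_div_count_eq (S : Set V) (x : V) :
    (∑' t : List V, if IsLoopAt G x t ∧ Avoids S t ∧ t ≠ [] then
        r ^ t.length / t.count x else 0) =
      ∑' k : ℕ, loopsWith G r S x (k + 1) / ((k + 1 : ℕ) : ℝ≥0∞) := by
  have e : ∀ t : List V,
      (if IsLoopAt G x t ∧ Avoids S t ∧ t ≠ [] then r ^ t.length / t.count x else 0) =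
        ∑' k : ℕ, if IsLoopAt G x t ∧ Avoids S t ∧ t.count x = k + 1 then
          r ^ t.length / ((k + 1 : ℕ) : ℝ≥0∞) else 0 := by
    intro t
    by_cases hT : IsLoopAt G x t ∧ Avoids S t
    · by_cases hne : t = []
      · subst hne
        simp
      · obtain ⟨m, hm⟩ : ∃ m, t.count x = m + 1 :=
          Nat.exists_eq_succ_of_ne_zero
            (List.count_pos_iff.2 (List.mem_of_getLast? (hT.1.getLast? hne))).ne'
        rw [if_pos ⟨hT.1, hT.2, hne⟩, hm, tsum_eq_single m]
        · rw [if_pos ⟨hT.1, hT.2, rfl⟩]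
        · intro k hk
          rw [if_neg]
          rintro ⟨-, -, h⟩
          exact hk (Nat.succ_injective h).symm
    · rw [if_neg (fun h => hT ⟨h.1, h.2.1⟩)]
      symm
      exact ENNReal.tsum_eq_zero.2 fun k => if_neg fun h => hT ⟨h.1, h.2.1⟩
  simp_rw [e]
  rw [ENNReal.tsum_comm]
  refine tsum_congr fun k => ?_
  rw [loopsWith, ENNReal.div_eq_inv_mul, ← ENNReal.tsum_mul_left]
  refine tsum_congr fun t => ?_
  split_ifs <;> simp [ENNReal.div_eq_inv_mul]

/-- **`m[ℒ(A∖S; x)] = ∑_{k ≥ 1} f_x^k / k`** (Lawler 2018, proof of Prop. 5.2, first display).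
[cite: Lawler2018, Proposition 5.2 (proof)] -/
theorem massThrough_eq_tsum_pow {S : Set V} {x : V} (hx : x ∉ S) :
    massThrough G r S x = ∑' k : ℕ, excursion G r S x ^ (k + 1) / ((k + 1 : ℕ) : ℝ≥0∞) := by
  rw [massThrough_eq_tsum_div_count, tsum_div_count_eq]
  simp_rw [loopsWith_eq_pow hx]

/-- **Lawler 2018, Proposition 5.2, first part: `exp{m[ℒ(A;x)]} = G_A(x,x)`** (here in `A ∖ S`),
via `-log(1 - f) = ∑_k f^k/k`: for an integrable weight (`G_{A∖S}(x,x) < ∞`) the loop measure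
of the loops through `x` is finite and its exponential is the Green's function.
[cite: Lawler2018, Proposition 5.2] -/
theorem toReal_green_eq_exp {S : Set V} {x : V} (hx : x ∉ S) (hg : green G r S x ≠ ⊤) :
    massThrough G r S x ≠ ⊤ ∧
      (green G r S x).toReal = Real.exp ((massThrough G r S x).toReal) := by
  set f := excursion G r S x with hf_def
  have hf1 : f < 1 := excursion_lt_one hx hg
  have hfT : f ≠ ⊤ := hf1.ne_top
  have hmass : massThrough G r S x = ∑' k : ℕ, f ^ (k + 1) / ((k + 1 : ℕ) : ℝ≥0∞) :=
    massThrough_eq_tsum_pow hx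
  have hgreen : green G r S x = (1 - f)⁻¹ := green_eq_inv hx
  have hle : (∑' k : ℕ, f ^ (k + 1) / ((k + 1 : ℕ) : ℝ≥0∞)) ≤ ∑' k : ℕ, f ^ (k + 1) := by
    refine ENNReal.tsum_le_tsum fun k => ENNReal.div_le_of_le_mul ?_
    refine le_mul_of_one_le_right zero_le ?_
    exact_mod_cast Nat.succ_pos k
  have hfin : massThrough G r S x ≠ ⊤ := by
    rw [hmass]
    refine ne_top_of_le_ne_top ?_ hle
    rw [ENNReal.tsum_geometric_add_one]
    exact ENNReal.mul_ne_top hfT (ENNReal.inv_ne_top.2 (tsub_pos_iff_lt.2 hf1).ne')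
  refine ⟨hfin, ?_⟩
  set s := f.toReal with hs
  have hs0 : 0 ≤ s := ENNReal.toReal_nonneg
  have hs1 : s < 1 := by
    have h := (ENNReal.toReal_lt_toReal hfT ENNReal.one_ne_top).2 hf1
    simpa using h
  have hterm : ∀ k : ℕ, (f ^ (k + 1) / ((k + 1 : ℕ) : ℝ≥0∞)).toReal = s ^ (k + 1) / (k + 1) := by
    intro k
    rw [ENNReal.toReal_div, ENNReal.toReal_pow, ENNReal.toReal_natCast]
    push_cast
    rfl
  have hsum : (massThrough G r S x).toReal = -Real.log (1 - s) := by
    rw [hmass, ENNReal.tsum_toReal_eq (fun k => ENNReal.div_ne_top (ENNReal.pow_ne_top hfT)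
      (by exact_mod_cast Nat.succ_ne_zero k))]
    simp_rw [hterm]
    exact (Real.hasSum_pow_div_log_of_abs_lt_one (by rwa [abs_of_nonneg hs0])).tsum_eq
  rw [hsum, Real.exp_neg, Real.exp_log (by linarith), hgreen, ENNReal.toReal_inv,
    ENNReal.toReal_sub_of_le hf1.le ENNReal.one_ne_top, ENNReal.toReal_one]

/-! ### Proposition 5.2 (second part): the partition of `ℒ(A;B)` -/

/-- The loops meeting `{a}` are the loops through `a`. [folklore] -/
theorem massMeeting_singleton (S : Set V) (a : V) :
    massMeeting G r S {v | v ∈ [a]} = massThrough G r S a := by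
  unfold massMeeting massThrough
  refine tsum_congr fun t => ?_
  refine ite_congr_prop _ _ ?_
  simp

/-- **The partition `ℒ(A;B) = ℒ(A;x₁) ∪ ℒ(A₁;x₂) ∪ ⋯`** (Lawler 2018, proof of Prop. 5.2, second
bullet), one step: the loops in `A ∖ S` meeting `{a} ∪ L` are the loops through `a` together
with the loops in `A ∖ (S ∪ {a})` meeting `L`, disjointly. [cite: Lawler2018, Proposition 5.2 (proof)] -/
theorem massMeeting_cons (S : Set V) (a : V) (L : List V) :
    massMeeting G r S {v | v ∈ a :: L} =
      massThrough G r S a + massMeeting G r (insert a S) {v | v ∈ L} := by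
  unfold massMeeting massThrough
  rw [← ENNReal.tsum_add]
  refine tsum_congr fun t => ?_
  by_cases hat : a ∈ t
  · have h2 : ¬ (IsCyc G.Adj t ∧ Avoids (insert a S) t ∧ ∃ v ∈ t, v ∈ {v | v ∈ L}) := by
      rintro ⟨-, hav, -⟩
      exact (avoids_insert.1 hav).1 hat
    rw [if_neg h2, add_zero]
    refine ite_congr_prop _ _ ?_
    simp only [Set.mem_setOf_eq, List.mem_cons]
    exact ⟨fun h => ⟨h.1, h.2.1, hat⟩, fun h => ⟨h.1, h.2.1, a, hat, Or.inl rfl⟩⟩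
  · have h1 : ¬ (IsCyc G.Adj t ∧ Avoids S t ∧ a ∈ t) := fun h => hat h.2.2
    rw [if_neg h1, zero_add]
    refine ite_congr_prop _ _ ?_
    simp only [Set.mem_setOf_eq, List.mem_cons, avoids_insert]
    constructor
    · rintro ⟨hc, hav, v, hv, hvL⟩
      rcases hvL with rfl | hvL
      · exact absurd hv hat
      · exact ⟨hc, ⟨hat, hav⟩, v, hv, hvL⟩
    · rintro ⟨hc, ⟨-, hav⟩, v, hv, hvL⟩
      exact ⟨hc, hav, v, hv, Or.inr hvL⟩

/-- **Lawler 2018, Propositions 3.1 + 5.2 combined, in `A ∖ S`:**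
`lawlerF S η = q(η) exp{m[ℒ(A∖S; η)]}`, with all quantities finite, for an integrable weight
(`∑_{ω from x} q(ω) < ∞` for every `x`) and a self-avoiding `η` avoiding `S`.
[cite: Lawler2018, Proposition 3.1 and Proposition 5.2] -/
theorem toReal_lawlerF (hr : r ≠ ⊤) (hfin : ∀ x, total G r x ≠ ⊤) {S : Set V} {a b : V}
    (η : G.Walk a b) (hη : η.IsPath) (hS : Avoids S η.support) :
    lawlerF G r S η ≠ ⊤ ∧ massMeeting G r S {v | v ∈ η.support} ≠ ⊤ ∧
      (lawlerF G r S η).toReal =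
        r.toReal ^ η.length * Real.exp ((massMeeting G r S {v | v ∈ η.support}).toReal) := by
  induction η generalizing S with
  | nil =>
    rename_i a
    rw [SimpleGraph.Walk.support_nil, avoids_cons] at hS
    have hg : green G r S a ≠ ⊤ := ne_top_of_le_ne_top (hfin a) (green_le_total S a)
    obtain ⟨hm, hexp⟩ := toReal_green_eq_exp hS.1 hg
    rw [SimpleGraph.Walk.support_nil, lawlerF_nil, massMeeting_singleton,
      SimpleGraph.Walk.length_nil, pow_zero, one_mul]
    exact ⟨hg, hm, hexp⟩
  | cons h η' ih =>
    rename_i a c b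
    rw [SimpleGraph.Walk.cons_isPath_iff] at hη
    rw [SimpleGraph.Walk.support_cons, avoids_cons] at hS
    have hg : green G r S a ≠ ⊤ := ne_top_of_le_ne_top (hfin a) (green_le_total S a)
    obtain ⟨hm, hexp⟩ := toReal_green_eq_exp hS.1 hg
    obtain ⟨hF', hM', hexp'⟩ := ih hη.1 (avoids_insert.2 ⟨hη.2, hS.2⟩)
    rw [SimpleGraph.Walk.support_cons, lawlerF_cons, massMeeting_cons,
      SimpleGraph.Walk.length_cons]
    refine ⟨ENNReal.mul_ne_top (ENNReal.mul_ne_top hg hr) hF', ENNReal.add_ne_top.2 ⟨hm, hM'⟩, ?_⟩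
    rw [ENNReal.toReal_mul, ENNReal.toReal_mul, ENNReal.toReal_add hm hM', Real.exp_add, hexp,
      hexp', pow_succ]
    ring

end LoopMeasure

/-! ### Walks of length `n` and the integrability of the weight -/

section PathsLen

variable {V : Type*} (G : SimpleGraph V) (r : ℝ≥0∞)

/-- The total weight `r^n · #{walks of length n from x}` of the walks of `G` of length `n` from
`x` (the `x`-row sum of `Qⁿ`, Lawler 2018, §2). [folklore] -/
def pathsLen (n : ℕ) (x : V) : ℝ≥0∞ :=
  ∑' t : List V, if List.IsChain G.Adj (x :: t) ∧ t.length = n then r ^ n else 0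

variable {G r}

/-- Only the trivial walk has length `0`. [folklore] -/
theorem pathsLen_zero (x : V) : pathsLen G r 0 x = 1 := by
  unfold pathsLen
  rw [tsum_eq_single ([] : List V)]
  · simp
  · intro t ht
    rw [if_neg]
    rintro ⟨-, h⟩
    exact ht (List.eq_nil_of_length_eq_zero h)

/-- First-step decomposition: `Q^{n+1}(x, ·) = ∑_{u ∼ x} r Qⁿ(u, ·)`. [folklore] -/
theorem pathsLen_succ (n : ℕ) (x : V) :
    pathsLen G r (n + 1) x = r * ∑' u : V, if G.Adj x u then pathsLen G r n u else 0 := by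
  unfold pathsLen
  rw [tsum_eq_tsum_prod_cons _ (by simp), ENNReal.tsum_prod', ← ENNReal.tsum_mul_left]
  refine tsum_congr fun u => ?_
  by_cases hu : G.Adj x u
  · rw [if_pos hu, ← ENNReal.tsum_mul_left]
    refine tsum_congr fun t => ?_
    simp only [List.isChain_cons_cons, List.length_cons, Nat.add_right_cancel_iff, hu, true_and]
    split_ifs
    · rw [pow_succ']
    · rw [mul_zero]
  · rw [if_neg hu, mul_zero]
    refine ENNReal.tsum_eq_zero.2 fun t => if_neg ?_
    rintro ⟨h, -⟩
    exact hu (List.isChain_cons_cons.1 h).1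

/-- `∑_{ω from x} q(ω) = ∑_n Qⁿ(x, A)`. [folklore] -/
theorem total_eq_tsum_pathsLen (x : V) : total G r x = ∑' n, pathsLen G r n x := by
  unfold total pathsLen
  rw [tsum_eq_tsum_fiber _ List.length]
  refine tsum_congr fun n => tsum_congr fun t => ?_
  by_cases h : t.length = n
  · simp [h]
  · simp [h]

/-- Sub-multiplicativity: if `Qⁿ(u, A) ≤ C` for all `u` then `Q^{n+m}(x, A) ≤ C Q^m(x, A)`.
[folklore] -/
theorem pathsLen_add_le {n : ℕ} {C : ℝ≥0∞} (hC : ∀ u, pathsLen G r n u ≤ C) (m : ℕ) (x : V) :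
    pathsLen G r (n + m) x ≤ C * pathsLen G r m x := by
  induction m generalizing x with
  | zero => simpa [pathsLen_zero] using hC x
  | succ m ih =>
    rw [← add_assoc, pathsLen_succ, pathsLen_succ, mul_left_comm]
    gcongr
    rw [← ENNReal.tsum_mul_left]
    refine ENNReal.tsum_le_tsum fun u => ?_
    split_ifs
    · exact ih u
    · simp

end PathsLen

/-! ### The killed simple random walk on a finite-edge subgraph of `ℤ²` is integrable -/

section Lattice

/-- The first coordinate vector `e₀ = (1, 0)` of `ℤ²`. [folklore] -/
def e0 : Site 2 := Pi.single 0 1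

variable {G : SimpleGraph (Site 2)}

/-- Bounding a sum over the `G`-neighbours of `x` (`G ≤ ℤ²`): the neighbour `x + e₀` contributes
at most `C'`, the at most three others (`card_neighborFinset_zdGraph_holds`) at most `C` each.
[folklore] -/
theorem tsum_adj_le (hG : G ≤ zdGraph 2) (x : Site 2) (F : Site 2 → ℝ≥0∞) {C C' : ℝ≥0∞}
    (h0 : (if G.Adj x (x + e0) then F (x + e0) else 0) ≤ C') (hC : ∀ u, G.Adj x u → F u ≤ C) :
    (∑' u, if G.Adj x u then F u else 0) ≤ C' + 3 * C := by
  have hself : x + e0 ∈ (zdGraph 2).neighborFinset x :=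
    (SimpleGraph.mem_neighborFinset _ _ _).2 ((zdGraph_adj_iff _ _).2 ⟨0, Or.inl rfl⟩)
  rw [tsum_eq_sum (s := (zdGraph 2).neighborFinset x) (fun u hu => if_neg (fun h => hu
      ((SimpleGraph.mem_neighborFinset _ _ _).2 (hG h)))),
    ← Finset.add_sum_erase _ _ hself]
  refine add_le_add h0 ?_
  calc ∑ u ∈ ((zdGraph 2).neighborFinset x).erase (x + e0), (if G.Adj x u then F u else 0)
      ≤ ∑ u ∈ ((zdGraph 2).neighborFinset x).erase (x + e0), C :=
        Finset.sum_le_sum fun u _ => by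
          split_ifs with h
          · exact hC u h
          · exact zero_le
    _ = (((zdGraph 2).neighborFinset x).erase (x + e0)).card * C := by
        rw [Finset.sum_const, nsmul_eq_mul]
    _ ≤ 3 * C := by
        gcongr
        have h1 := Finset.card_erase_of_mem hself
        have h2 := card_neighborFinset_zdGraph_holds (d := 2) x
        exact_mod_cast (by omega : (((zdGraph 2).neighborFinset x).erase (x + e0)).card ≤ 3)

/-- The killed walk is substochastic: `Qⁿ(x, A) ≤ 1` for `q ≡ 1/4` on `G ≤ ℤ²`. [folklore] -/
theorem pathsLen_le_one (hG : G ≤ zdGraph 2) (n : ℕ) (x : Site 2) : pathsLen G 4⁻¹ n x ≤ 1 := by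
  induction n generalizing x with
  | zero => rw [pathsLen_zero]
  | succ n ih =>
    rw [pathsLen_succ]
    have h := tsum_adj_le hG x (pathsLen G 4⁻¹ n) (C := 1) (C' := 1)
      (by split_ifs <;> simp [ih]) (fun u _ => ih u)
    calc 4⁻¹ * (∑' u, if G.Adj x u then pathsLen G 4⁻¹ n u else 0) ≤ 4⁻¹ * (1 + 3 * 1) := by
          gcongr
      _ = 1 := by
          rw [mul_one, show (1 : ℝ≥0∞) + 3 = 4 by norm_num,
            ENNReal.inv_mul_cancel (by norm_num) (by norm_num)]

/-- **The escape estimate**: if the straight ray `x, x + e₀, x + 2e₀, …` uses a non-edge of `G`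
within `k` steps, the walk from `x` is killed within `k` steps with probability `≥ 4^{-k}`:
`Q^k(x, A) ≤ 1 - 4^{-k}`. [folklore] -/
theorem pathsLen_add_pow_le_one (hG : G ≤ zdGraph 2) (k : ℕ) (x : Site 2)
    (hx : ∃ j < k, ¬ G.Adj (x + j • e0) (x + (j + 1) • e0)) :
    pathsLen G 4⁻¹ k x + 4⁻¹ ^ k ≤ 1 := by
  induction k generalizing x with
  | zero =>
    obtain ⟨j, hj, -⟩ := hx
    exact absurd hj (Nat.not_lt_zero j)
  | succ k ih =>
    obtain ⟨j, hj, hnadj⟩ := hx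
    have hpow : (4⁻¹ : ℝ≥0∞) ^ k ≤ 1 := pow_le_one₀ zero_le (ENNReal.inv_le_one.2 (by norm_num))
    -- the neighbour sum plus the escape mass is at most `4`
    have key : (∑' u, if G.Adj x u then pathsLen G 4⁻¹ k u else 0) + 4⁻¹ ^ k ≤ 4 := by
      by_cases hadj : G.Adj x (x + e0)
      · -- the ray continues: `j = j' + 1`, induction hypothesis at `x + e₀`
        obtain ⟨j', rfl⟩ : ∃ j', j = j' + 1 := by
          refine Nat.exists_eq_succ_of_ne_zero ?_
          rintro rfl
          exact hnadj (by simpa using hadj)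
        have e1 : x + (j' + 1) • e0 = x + e0 + j' • e0 := by
          rw [succ_nsmul]
          abel
        have e2 : x + (j' + 1 + 1) • e0 = x + e0 + (j' + 1) • e0 := by
          rw [succ_nsmul e0 (j' + 1)]
          abel
        rw [e1, e2] at hnadj
        have ih' := ih (x + e0) ⟨j', by omega, hnadj⟩
        have h := tsum_adj_le hG x (pathsLen G 4⁻¹ k) (C := 1) (C' := pathsLen G 4⁻¹ k (x + e0))
          (by rw [if_pos hadj]) (fun u _ => pathsLen_le_one hG k u)
        calc (∑' u, if G.Adj x u then pathsLen G 4⁻¹ k u else 0) + 4⁻¹ ^ k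
            ≤ (pathsLen G 4⁻¹ k (x + e0) + 3 * 1) + 4⁻¹ ^ k := by gcongr
          _ = (pathsLen G 4⁻¹ k (x + e0) + 4⁻¹ ^ k) + 3 := by ring
          _ ≤ 1 + 3 := by gcongr
          _ = 4 := by norm_num
      · have h := tsum_adj_le hG x (pathsLen G 4⁻¹ k) (C := 1) (C' := 0)
          (by rw [if_neg hadj]) (fun u _ => pathsLen_le_one hG k u)
        calc (∑' u, if G.Adj x u then pathsLen G 4⁻¹ k u else 0) + 4⁻¹ ^ k
            ≤ (0 + 3 * 1) + 1 := by gcongr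
          _ = 4 := by norm_num
    rw [pathsLen_succ, pow_succ', ← mul_add]
    calc (4⁻¹ : ℝ≥0∞) * ((∑' u, if G.Adj x u then pathsLen G 4⁻¹ k u else 0) + 4⁻¹ ^ k)
        ≤ 4⁻¹ * 4 := by gcongr
      _ = 1 := ENNReal.inv_mul_cancel (by norm_num) (by simp)

/-- The vertices of `G` carrying an edge form a finite set when `G` has finitely many edges.
[folklore] -/
theorem finite_support_of_finite_edgeSet {W : Type*} {H : SimpleGraph W} (h : H.edgeSet.Finite) :
    H.support.Finite := by
  have hsub : H.support ⊆ ⋃ e ∈ H.edgeSet, {v | v ∈ e} := by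
    intro v hv
    obtain ⟨w, hvw⟩ := hv
    exact Set.mem_biUnion ((SimpleGraph.mem_edgeSet H).2 hvw) (Sym2.mem_mk_left v w)
  refine (h.biUnion fun e _ => ?_).subset hsub
  induction e using Sym2.ind with
  | _ a b =>
    refine (Set.toFinite ({a, b} : Set W)).subset ?_
    intro v hv
    simp only [Set.mem_setOf_eq, Sym2.mem_iff] at hv
    rcases hv with rfl | rfl <;> simp

/-- **A uniform escape time**: on a subgraph of `ℤ²` with finitely many edges, from every vertex
the straight ray in direction `e₀` meets a non-edge of `G` within `N` steps, `N` = (number of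
non-isolated vertices) `+ 1` (pigeonhole). [folklore] -/
theorem exists_escape (hfin : G.edgeSet.Finite) :
    ∃ N : ℕ, 0 < N ∧ ∀ x : Site 2, ∃ j < N, ¬ G.Adj (x + j • e0) (x + (j + 1) • e0) := by
  have hA := finite_support_of_finite_edgeSet hfin
  refine ⟨hA.toFinset.card + 1, Nat.succ_pos _, fun x => ?_⟩
  by_contra hcon
  simp only [not_exists, not_and, not_not] at hcon
  have hmem : ∀ j ∈ Finset.range (hA.toFinset.card + 1), x + j • e0 ∈ hA.toFinset := by
    intro j hj
    rw [Set.Finite.mem_toFinset]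
    exact ⟨_, hcon j (Finset.mem_range.1 hj)⟩
  have hinj : Set.InjOn (fun j : ℕ => x + j • e0) (Finset.range (hA.toFinset.card + 1) : Set ℕ) := by
    intro j _ j' _ hjj'
    have h := congrFun hjj' 0
    simpa [e0, Pi.single_eq_same] using h
  have hcard := Finset.card_le_card_of_injOn (fun j : ℕ => x + j • e0) hmem hinj
  rw [Finset.card_range] at hcard
  omega

/-- **Integrability of the killed simple random walk** (Lawler 2018, §2: the Type II walk with
`q ≡ 1/4` on a finite `A ⊂ ℤ²` is an integrable weight): on a subgraph `G ≤ ℤ²` with finitely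
many edges, `∑_{ω from x} 4^{-|ω|} < ∞` for every `x`. [cite: Lawler2018, §2 (integrable weights)] -/
theorem total_ne_top (hG : G ≤ zdGraph 2) (hfin : G.edgeSet.Finite) (x : Site 2) :
    total G 4⁻¹ x ≠ ⊤ := by
  obtain ⟨N, hN, hesc⟩ := exists_escape hfin
  haveI : NeZero N := ⟨hN.ne'⟩
  set θ : ℝ≥0∞ := 1 - 4⁻¹ ^ N with hθ
  have hθ1 : θ < 1 := ENNReal.sub_lt_self ENNReal.one_ne_top one_ne_zero
    (pow_ne_zero _ (ENNReal.inv_ne_zero.2 (by simp)))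
  have hPN : ∀ y, pathsLen G 4⁻¹ N y ≤ θ := fun y =>
    ENNReal.le_sub_of_add_le_right (ENNReal.pow_ne_top (ENNReal.inv_ne_top.2 (by norm_num)))
      (pathsLen_add_pow_le_one hG N y (hesc y))
  -- `Q^{kN}(y, A) ≤ θ^k`
  have hmul : ∀ k y, pathsLen G 4⁻¹ (k * N) y ≤ θ ^ k := by
    intro k
    induction k with
    | zero => intro y; simp [pathsLen_zero]
    | succ k ih =>
      intro y
      rw [Nat.succ_mul, pow_succ]
      exact (pathsLen_add_le ih N y).trans (by gcongr; exact hPN y)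
  -- `Q^{kN + i}(y, A) ≤ θ^k`
  have hbound : ∀ (k i : ℕ) (y : Site 2), pathsLen G 4⁻¹ (k * N + i) y ≤ θ ^ k := by
    intro k i y
    rw [add_comm]
    exact (pathsLen_add_le (fun u => pathsLen_le_one hG i u) (k * N) y).trans
      (by rw [one_mul]; exact hmul k y)
  rw [total_eq_tsum_pathsLen, ← (Nat.divModEquiv N).symm.tsum_eq]
  simp only [Nat.divModEquiv_symm_apply]
  refine ne_top_of_le_ne_top ?_ (ENNReal.tsum_le_tsum fun p => hbound p.1 p.2 x)
  rw [ENNReal.tsum_prod', ENNReal.tsum_comm]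
  simp only [ENNReal.tsum_geometric]
  rw [tsum_fintype, Finset.sum_const, Finset.card_univ, Fintype.card_fin, nsmul_eq_mul]
  exact ENNReal.mul_ne_top (ENNReal.natCast_ne_top N)
    (ENNReal.inv_ne_top.2 (tsub_pos_iff_lt.2 hθ1).ne')

end Lattice

/-! ### From walks of `G` to vertex lists -/

section Conversion

variable {V : Type*} (G : SimpleGraph V) (r : ℝ≥0∞)

/-- `loopErase` does not depend on the `DecidableEq` instance used to compute it. [folklore] -/
theorem loopErase_eq_loopErase (i₁ i₂ : DecidableEq V) (l : List V) :
    @loopErase V i₁ l = @loopErase V i₂ l := by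
  have h : i₁ = i₂ := Subsingleton.elim _ _
  subst h
  rfl

/-- **A walk of a simple graph is its vertex list**: `ω ↦ ω.support` identifies the walks from
`a` to `b` with the `G.Adj`-chains from `a` to `b` (inverse: `Walk.ofSupport`). [folklore] -/
def walkEquivList (a b : V) :
    G.Walk a b ≃ {w : List V // w.IsChain G.Adj ∧ w.head? = some a ∧ w.getLast? = some b} where
  toFun ω := ⟨ω.support, ω.isChain_adj_support,
    by rw [List.head?_eq_some_head ω.support_ne_nil, SimpleGraph.Walk.head_support],
    by rw [List.getLast?_eq_some_getLast ω.support_ne_nil, SimpleGraph.Walk.getLast_support]⟩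
  invFun w :=
    have hne : w.1 ≠ [] := by
      intro h
      have h1 := w.2.2.1
      rw [h] at h1
      simp at h1
    (SimpleGraph.Walk.ofSupport w.1 hne w.2.1).copy
      (by
        have h1 := w.2.2.1
        rw [List.head?_eq_some_head hne, Option.some_inj] at h1
        exact h1)
      (by
        have h1 := w.2.2.2
        rw [List.getLast?_eq_some_getLast hne, Option.some_inj] at h1
        exact h1)
  left_inv ω := by
    apply SimpleGraph.Walk.ext_support
    rw [SimpleGraph.Walk.support_copy, SimpleGraph.Walk.support_ofSupport]
  right_inv w := by
    apply Subtype.ext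
    simp only
    rw [SimpleGraph.Walk.support_copy, SimpleGraph.Walk.support_ofSupport]

/-- Transport of a sum over walks to a sum over vertex lists (`|ω| = |support ω| - 1`).
[folklore] -/
theorem tsum_walk_eq_tsum_list (a b : V) (F : List V → ℕ → ℝ≥0∞) :
    ∑' ω : G.Walk a b, F ω.support ω.length =
      ∑' w : List V, if w.IsChain G.Adj ∧ w.head? = some a ∧ w.getLast? = some b then
        F w (w.length - 1) else 0 := by
  rw [← (walkEquivList G a b).symm.tsum_eq]
  have h1 : ∀ c : {w : List V // w.IsChain G.Adj ∧ w.head? = some a ∧ w.getLast? = some b},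
      F ((walkEquivList G a b).symm c).support ((walkEquivList G a b).symm c).length =
        F c.1 (c.1.length - 1) := by
    intro c
    simp only [walkEquivList, Equiv.coe_fn_symm_mk, SimpleGraph.Walk.support_copy,
      SimpleGraph.Walk.support_ofSupport, SimpleGraph.Walk.length_copy,
      SimpleGraph.Walk.length_ofSupport]
  rw [tsum_congr h1, tsum_subtype_eq_tsum_ite
      (fun w : List V => w.IsChain G.Adj ∧ w.head? = some a ∧ w.getLast? = some b)
      (fun w => F w (w.length - 1))]
  exact tsum_congr fun w => ite_congr_prop _ _ Iff.rfl

/-- **The left-hand side as a list sum**: for any rendering `LE'` of chronological loop erasure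
(computed with any `DecidableEq` instance), `∑_{ω : a → b, LE(ω) = η} r^{|ω|} = lesum ∅ η`.
[folklore] -/
theorem tsum_walk_ite_eq_lesum {a b : V} (η : G.Walk a b) (LE' : List V → List V)
    (hLE : ∀ l, LE' l = loopErase l) :
    (∑' ω : G.Walk a b, if LE' ω.support = η.support then r ^ ω.length else 0) =
      lesum G r ∅ η.support := by
  have e : ∀ ω : G.Walk a b, (if LE' ω.support = η.support then r ^ ω.length else 0) =
      if loopErase ω.support = η.support then r ^ ω.length else 0 := by
    intro ω
    refine ite_congr_prop _ _ ?_
    rw [hLE]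
  simp_rw [e]
  rw [tsum_walk_eq_tsum_list G a b (fun w n => if loopErase w = η.support then r ^ n else 0)]
  unfold lesum
  refine tsum_congr fun w => ?_
  by_cases hle : loopErase w = η.support
  · have hh : w.head? = some a := by
      rw [← head?_loopErase, hle, List.head?_eq_some_head η.support_ne_nil,
        SimpleGraph.Walk.head_support]
    have hl : w.getLast? = some b := by
      rw [← getLast?_loopErase, hle, List.getLast?_eq_some_getLast η.support_ne_nil,
        SimpleGraph.Walk.getLast_support]
    simp [hle, hh, hl]
  · simp [hle]

/-- **The loop measure as a list sum**: the tree's `rwLoopMass`-shaped sum over rooted closed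
walks `(x, ω : x → x)` of positive length meeting `W`, of `r^{|ω|}/|ω|`, is `massMeeting ∅ W`
(a rooted loop of positive length ↦ the tail of its vertex list). [folklore] -/
theorem tsum_sigma_walk_eq_massMeeting (W : Set V) :
    (∑' p : (Σ x : V, G.Walk x x),
      if 0 < p.2.length ∧ ∃ v ∈ p.2.support, v ∈ W then r ^ p.2.length / p.2.length else 0) =
      massMeeting G r ∅ W := by
  rw [ENNReal.tsum_sigma']
  have e1 : ∀ x : V, (∑' ω : G.Walk x x,
      if 0 < ω.length ∧ ∃ v ∈ ω.support, v ∈ W then r ^ ω.length / ω.length else 0) =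
      ∑' w : List V, if (w.IsChain G.Adj ∧ w.head? = some x ∧ w.getLast? = some x) then
        (if 0 < w.length - 1 ∧ ∃ v ∈ w, v ∈ W then
          r ^ (w.length - 1) / (w.length - 1 : ℕ) else 0) else 0 :=
    fun x => tsum_walk_eq_tsum_list G x x
      (fun w n => if 0 < n ∧ ∃ v ∈ w, v ∈ W then r ^ n / n else 0)
  simp only [e1]
  rw [ENNReal.tsum_comm]
  rw [tsum_eq_tsum_prod_cons _ ?hF0]
  case hF0 => simp
  rw [ENNReal.tsum_prod', ENNReal.tsum_comm]
  unfold massMeeting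
  refine tsum_congr fun t => ?_
  -- the sum over `x` collapses to `x = y`
  have e2 : ∀ y : V, (∑' x : V,
      if ((y :: t).IsChain G.Adj ∧ (y :: t).head? = some x ∧ (y :: t).getLast? = some x) then
        (if 0 < (y :: t).length - 1 ∧ ∃ v ∈ y :: t, v ∈ W then
          r ^ ((y :: t).length - 1) / ((y :: t).length - 1 : ℕ) else 0) else 0) =
      if (y :: t).IsChain G.Adj ∧ t.getLast? = some y ∧ ∃ v ∈ t, v ∈ W then
        r ^ t.length / t.length else 0 := by
    intro y
    rw [tsum_eq_single y]
    · simp only [List.head?_cons, true_and, List.length_cons, Nat.add_sub_cancel]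
      by_cases ht : t = []
      · subst ht
        simp
      · rw [getLast?_cons_of_ne_nil y ht]
        by_cases hc : (y :: t).IsChain G.Adj ∧ t.getLast? = some y
        · rw [if_pos hc]
          refine ite_congr_prop _ _ ?_
          have hy : y ∈ t := List.mem_of_getLast? hc.2
          constructor
          · rintro ⟨-, v, hv, hvW⟩
            rcases List.mem_cons.1 hv with rfl | hv
            · exact ⟨hc.1, hc.2, v, hy, hvW⟩
            · exact ⟨hc.1, hc.2, v, hv, hvW⟩
          · rintro ⟨-, -, v, hv, hvW⟩
            exact ⟨List.length_pos_iff.2 ht, v, List.mem_cons_of_mem y hv, hvW⟩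
        · rw [if_neg hc, if_neg (fun h => hc ⟨h.1, h.2.1⟩)]
    · intro x hx
      rw [if_neg]
      rintro ⟨-, h, -⟩
      simp only [List.head?_cons, Option.some.injEq] at h
      exact hx h.symm
  rw [tsum_congr e2]
  -- the sum over the root `y` collapses to `y = t.getLast`
  by_cases ht : t = []
  · subst ht
    simp [IsCyc]
  · rw [tsum_eq_single (t.getLast ht)]
    · refine ite_congr_prop _ _ ?_
      rw [isCyc_iff_getLast ht, List.getLast?_eq_some_getLast ht]
      simp
    · intro y hy
      rw [if_neg]
      rintro ⟨-, h, -⟩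
      rw [List.getLast?_eq_some_getLast ht, Option.some_inj] at h
      exact hy h.symm

end Conversion

end LoopErasedWalkIdentity

/-! ### The discharge -/

open LoopErasedWalkIdentity in
/-- **Lawler's formula for the loop-erased measure of the simple random walk on a finite-edge
subgraph of `ℤ²`** — the tree's named fact `tsum_loopErase_eq_exp_rwLoopMass`, DISCHARGED:
for `G ≤ ℤ²` with finitely many edges and a self-avoiding `η : a → b` in `G`,
`∑_{ω : a → b, LE(ω) = η} 4^{-|ω|} = 4^{-|η|} exp{m[ℒ(G; η)]}`. Proof: Lawler 2018, Prop. 3.1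
(`q̂(η) = q(η) ∏_j G_{A_j}(η_j,η_j)`, here `lesum_support`) and Prop. 5.2
(`∏_j G_{A_j}(η_j,η_j) = F_η(A) = exp{m[ℒ(A;η)]}`, here `toReal_green_eq_exp` with the partition
`massMeeting_cons`), for the integrable (here `total_ne_top`) Type II weight `q ≡ 1/4`.
[cite: Lawler2018, Proposition 3.1 and Proposition 5.2] -/
theorem tsum_loopErase_eq_exp_rwLoopMass_holds : tsum_loopErase_eq_exp_rwLoopMass := by
  intro G hG hfin a b η hη
  have h4 : (4⁻¹ : ℝ≥0∞) ≠ ⊤ := ENNReal.inv_ne_top.2 (by norm_num)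
  -- the left-hand side is the `toReal` of `lesum ∅ η = lawlerF ∅ η`
  have h1 : ∀ ω : G.Walk a b,
      (if loopErase ω.support = η.support then ((1 : ℝ) / 4) ^ ω.length else 0) =
        (if loopErase ω.support = η.support then (4⁻¹ : ℝ≥0∞) ^ ω.length else 0).toReal := by
    intro ω
    split_ifs <;> simp
  have hL : (∑' ω : G.Walk a b,
      if loopErase ω.support = η.support then (4⁻¹ : ℝ≥0∞) ^ ω.length else 0) =
        lesum G 4⁻¹ ∅ η.support := by
    rw [← tsum_walk_ite_eq_lesum G 4⁻¹ η loopErase (fun l => loopErase_eq_loopErase _ _ l)]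
    exact tsum_congr fun ω => ite_congr_prop _ _ Iff.rfl
  rw [tsum_congr h1, ← ENNReal.tsum_toReal_eq (fun ω => by split_ifs <;> simp), hL,
    lesum_support η hη (avoids_empty _)]
  obtain ⟨-, -, h3⟩ := toReal_lawlerF (G := G) (r := 4⁻¹) h4 (total_ne_top hG hfin) η hη
    (S := ∅) (avoids_empty _)
  rw [h3]
  -- the right-hand side: `rwLoopMass` is the `toReal` of `massMeeting ∅`
  have h2 : rwLoopMass G {v | v ∈ η.support} =
      (massMeeting G 4⁻¹ ∅ {v | v ∈ η.support}).toReal := by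
    rw [← tsum_sigma_walk_eq_massMeeting G 4⁻¹ {v | v ∈ η.support},
      ENNReal.tsum_toReal_eq, ← tsum_ite_eq_rwLoopMass G _ (fun p => inferInstance)]
    · refine tsum_congr fun p => ?_
      split_ifs <;> simp [ENNReal.toReal_div, ENNReal.toReal_pow]
    · intro p
      split_ifs with h
      · exact ENNReal.div_ne_top (ENNReal.pow_ne_top h4) (by exact_mod_cast h.1.ne')
      · exact ENNReal.zero_ne_top
  rw [h2]
  simp

end Literature.Probability.LatticeModels
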